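import Mathlib
import HarnessLib
import HarnessLib.Audit
import Summits.Langlands.Statement
import Summits.Langlands.Langlands.Theses.WeilRestrictionSplit
import Literature.NumberTheory.GaloisRepresentations.HeckeCharacter
import Literature.NumberTheory.Automorphic.AutomorphicLFunction
import Summits.Langlands.Langlands.Theorems.WeilRestrictionSplitWeilRestrictionConstituent
import HarnessLib.Audit.Status.Attr

/-!
Route: HolomorphicLimitSplit

# Route HolomorphicLimitSplit — the irregular totally-real core of weak reciprocity split by the
HOLOMORPHIC-LIMIT dial (odd-signed polarization ∧ HT-multiplicity ≤ 2 ∧ rank ≤ 4: where higher Hida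
theory reaches) vs the dark core

Decomposition node of the Langlands root ladder (cell decomp-langlands, lens-3 gen 8 = ONE certified
translation + split beneath; RESIDUAL MODE, blocker
first). TARGET = IRR*_TR `WeilRestrictionSplit.NonRegularizableAutomorphy` stmt-Langlands-31691
(crux r2 of route WeilRestrictionSplit, its DECLARED
RESIDUAL #1: weak automorphy of the irreducible geometric ρ over TOTALLY REAL K that admit no
regularizing move). This child route is an ALTERNATIVE layer
beneath that decl («refines route-Langlands-WeilRestrictionSplit:NonRegularizableAutomorphy»; the
same split is ALSO kitted as a plain `--split` of 31691 on
the parent, Shape A — the writer files exactly one). It suffices to show X = HL_TR ∧ NL_TR ∧ LMT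
together with the parent's other binders verbatim
(B_CI, REG_TR, S1, S2, S3, MT, W⁺, P, L∤R, CRD), where the NEW dial is the HOLOMORPHIC-LIMIT MOVE
LIMMOVE(ρ/K) := the parent's saturated MOVE template
with «R′ Hodge–Tate regular» replaced by «R′ of HOLOMORPHIC-LIMIT TYPE»: rank R′ ≤ 4 ∧ R′ carries a
TOTALLY ODD-SIGNED POLARIZATION (a nondegenerate
B = ±Bᵀ on which Γ acts through R′ by similitudes with B·R′(c) SYMMETRIC for every complex
conjugation c — the Bellaïche–Chenevier / Taylor sign, typed
convention-free on matrices) ∧ every labelled Hodge–Tate weight of R′ has multiplicity ≤ 2. HL_TR =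
B_TR on the ρ of holomorphic-limit type that are not
HT-regular (the sector of holomorphic LIMITS OF DISCRETE SERIES = degree-0/1 coherent cohomology of
the PEL Shimura varieties of GL₂, GSp₄, GO₄ over
totally real fields, where weight-one glueing and higher Hida / higher Coleman theory live); NL_TR =
B_TR on the ρ with ¬MOVE ∧ ¬LIMMOVE (DECLARED
RESIDUAL: even Artin and its tensor shadows, multiplicity ≥ 3, rank ≥ 5, non-polarizable irregular);
LMT = the parent's move transport MT restricted to
holomorphic-limit avatars (support, closes from MT ∧ W⁺). Kernel certificates (node file
HOME/lens-3/g8/HolomorphicLimitSplit.lean, 0 sorry, axioms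
{propext, Classical.choice, Quot.sound}): IRR*_TR ⟸ HL_TR ∧ NL_TR ∧ LMT
(`nonRegularizable_of_split`, pure logic); EXACT one level up: B_TR ⟺ REG_TR ∧
HL_TR ∧ NL_TR modulo MT ∧ W⁺ (`totallyReal_iff_pieces₃`) and B_w ⟺ (REG_TR ∧ HL_TR ∧ NL_TR) ∧ B_CI
modulo S1 S2 S3 MT W⁺ (`weak_iff_pieces₃`); every
child Langlands-implied (`children_of_langlands`).
Lean: `HolomorphicLimitSplit.HolomorphicLimitAutomorphy ∧
HolomorphicLimitSplit.NonLimitIrregularAutomorphy ∧ HolomorphicLimitSplit.LimitMoveTransport` (with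
the parent's ConjugationInsolubleAutomorphy, RegularTotallyRealAutomorphy, SolvableGaloisAscent,
CliffordSolvableDescent, WeilRestrictionConstituent, RegularizingMoveTransport,
SatakeAvatarExistence, PadicMemberCompatibility, CompatibilityAwayFromLR, CanonicalReciprocityData
by identical statement text; constants `lean search --decl`-checked:
Literature.NumberTheory.GaloisRepresentations.FramedGaloisRep / .restrictField /
.labelledHodgeTateWeightsAt / IsComplexConjugation, FramedRep.trace, Field.absoluteGaloisGroup,
Literature.NumberTheory.PAdicHodge.fontainePstAdicCompletion,
Literature.NumberTheory.Automorphic.isCompact_glFiniteIntegralLevel / CuspidalAutomorphicRepData,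
Summit.Langlands.SatakeFrobCompatibleAt, Mathlib Matrix.transpose / Matrix.det / Multiset.count /
NumberField.IsTotallyReal / IsGalois / IsSolvable).

## Assembly
closes : HL_TR → NL_TR → LMT → B_CI → REG_TR → S1 → S2 → S3 → MT → W⁺ → P → L∤R → CRD → Langlands,
EVERY binder used: IRR*_TR is reassembled from
HL_TR ∧ NL_TR ∧ LMT (excluded middle on LIMMOVE; a limit move with an HT-regular avatar is a
regularizing move) and fed to the landed parent seam
`WeilRestrictionSplit.closes` (IRR*_TR ∧ B_CI ∧ REG_TR ∧ S1 ∧ S2 ∧ S3 ∧ MT ∧ W⁺ ∧ P ∧ L∤R ∧ CRD ⟹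
Langlands, itself through `PrimeSwitchSplit.closes`).
glue.lean inlines the one new kernel (certified `ledger route check --native`, rc 0).

Rationale: WHY THIS LINE. The irregular world over totally real fields is not uniformly dark: exactly where the
archimedean parameter is a HOLOMORPHIC LIMIT OF DISCRETE SERIES the
representation is realised in COHERENT cohomology (degrees 0 and 1) of a Shimura variety and two
engines exist — p-adic glueing of weight-one forms
(Buzzard–Taylor, Khare–Wintenberger [KhareWintenberger2009] Thm 10.1, Kassaei, Sasaki, Pilloni–Stroh
[PilloniStroh2016Asterisque] Thm 0.3; tree facts
`khareWintenberger_weightOne_of_isOdd`, `pilloniStroh_strongArtin_of_isIcosahedralType`,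
`Pan2022_fontaineMazurGL2_weightOne`) and higher Hida / higher
Coleman theory with Calegari–Geraghty patching (BCGP [arXiv:1812.09269], GSp₄ weight (k,2) over
totally real fields; tree fact
`bcgp2025_modThreeSurjective_modular_abelianSurface`). On the Galois side that sector has an
intrinsic description, stable
under the route's solvable transports and necessary under Langlands: the ρ carrying a TOTALLY
ODD-SIGNED polarization (Bellaïche–Chenevier [arXiv:0804.2860]
Thm 1.2: automorphic polarized ρ have sign +1, «A is symmetric»; Taylor [doi:10.2140/ant.2012.6.405]
for the totally real case) with labelled Hodge–Tate
multiplicities ≤ 2 (Goldring–Koskivirta [arXiv:1507.05032]: multiplicity ≤ 2 is the reach of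
coherent cohomology / limits of discrete series) in rank ≤ 4
(the accidental-isomorphism range GL₂, GSp₄ ≅ GSpin₅, GO₄ — Gross 2016: beyond it irregular
symplectic/orthogonal motives have no discrete-series
realisation). The dial is on the AVATAR R′ inside the parent's own move template, so both new cells
are unions of orbits of the route's transports by
construction (CRITIC-LEDGER rows 74/89), and the SIGN — not the trace of complex conjugation
(lens-1's dial, cheated by ρ_even ⊗ Ind(RM character): trace 0,
even-signed) nor multiplicity alone (lens-2's root dial, which lets Maass-type ρ in) — separates
KW/Pilloni–Stroh territory from the even icosahedral core;
that ρ_even ⊗ τ stays dark for every regular τ reachable by a solvable move is elementary (τ regular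
and potentially abelian over a solvable layer ⇒ monomial
from a totally imaginary field by Clifford; every polarization of such τ is totally odd by the
conjugate-block computation; A₅ does not die in a solvable
extension, so polarizations of ρ_even ⊗ τ are alt ⊗ pol(τ), totally even). Imported areas: Hodge
theory of Shimura varieties (limits of discrete series,
coherent cohomology), bilinear algebra (sign), Clifford–Mackey theory, p-adic Hodge theory. Versus
prior routes: it carves the parent's residual #1 by the
ENGINE CLASS in all ranks at once (lens-5-g7's WeightOneBridgeSplit on the same node cuts rank 2 ∧
IsOdd only: OA ∪ OB ∪ PW1 ⊂ HL_TR, REST ⊃ NL_TR).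

RANKED CRUXES. #2 HolomorphicLimitAutomorphy (crux) — [crux] HL_TR — HOLOMORPHIC-LIMIT AUTOMORPHY
over totally real fields (child 1/3 of IRR*_TR `NonRegularizableAutomorphy` 31691;
ATTACKABLE-BY-ENGINE; WEAKER than B_TR = B_w over totally real K, kernel `holomorphicLimit_of_weak`;
Langlands-implied): for every TOTALLY REAL K, 1 ≤ n ≤ 4, hcpt, (ℓ, ι) and every irreducible
geometric ρ : Γ_K → GL_n(ℚ̄_ℓ) which (i) carries a TOTALLY ODD-SIGNED POLARIZATION — a nondegenerate
symmetric-or-alternating matrix B on which Γ_K acts through ρ by similitudes (ρ(g)ᵀ B ρ(g) = s(g)·B)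
and such that B·ρ(c) is SYMMETRIC for EVERY complex conjugation c of K (the Bellaïche–Chenevier /
BLGGT sign +1 at all real places, typed on matrices) —, (ii) has every labelled Hodge–Tate weight of
multiplicity ≤ 2 (at every v ∣ ℓ, every label), and (iii) is NOT Hodge–Tate regular, ρ is weakly
automorphic (cuspidal L-algebraic π on GL_n(𝔸_K), Satake–Frobenius compatible a.e.). This is the
Galois-side description of the HOLOMORPHIC LIMIT-OF-DISCRETE-SERIES sector = what degree-0/1
COHERENT cohomology of the PEL Shimura varieties of GL₂/F, GSp₄/F ≅ GSpin₅, GO₄ reaches (rank ≤ 4 =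
accidental-isomorphism range; Goldring–Koskivirta: multiplicity ≤ 2 is the reach of coherent
cohomology; rank 3 is provably vacuous). PRINT boxes inside, cited BY NAME (content, not leaks):
weight-one odd Artin over ℚ
`Literature.NumberTheory.Automorphic.khareWintenberger_weightOne_of_isOdd` (KW 2009 Thm 10.1(ii))
and its Fontaine–Mazur form
`Literature.NumberTheory.Automorphic.Pan2022_fontaineMazurGL2_weightOne`; totally odd icosahedral
over totally real F
`Literature.NumberTheory.Automorphic.pilloniStroh_strongArtin_of_isIcosahedralType` (Pilloni–Stroh
Astérisque 382 Thm 0.3; Sasaki); abelian surfaces / GSp₄ weight (k,2) over totally real fields (BCGP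
2018 potential modularity arXiv:1812.09269;
`Literature.NumberTheory.DiophantineGeometry.bcgp2025_modThreeSurjective_modular_abelianSurface` =
BCGP 2025 Thm A); GO₄-type ρ_f ⊗ ρ_g (Ramakrishnan). OPEN boxes: partial weight one in general
(Diamond–Kassaei–Sasaki programme), GSp₄ (k,2) beyond residual hypotheses, p = 2. lens-5-g7's
OA/OB/PW1 (rank 2, IsOdd) are sub-cells of this cell. [difficulty: open-problem] [difficulty:
open-problem] (why it might fail: Beyond totally odd weight one (KW, Pilloni–Stroh, Sasaki) and
abelian surfaces / GSp₄ (k,2) under residual-image hypotheses (BCGP) no engine: partial weight one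
in general, small residual image, p = 2, GO₄ only via Ramakrishnan; higher Coleman theory gives
overconvergent, not classical, limits.) [arXiv:1812.09269, BoxerCalegariGeePilloni2025,
Literature.NumberTheory.DiophantineGeometry.bcgp2025_modThreeSurjective_modular_abelianSurface,
PilloniStroh2016Asterisque,
Literature.NumberTheory.Automorphic.pilloniStroh_strongArtin_of_isIcosahedralType,
KhareWintenberger2009, Literature.NumberTheory.Automorphic.khareWintenberger_weightOne_of_isOdd,
Pan2022LocallyAnalytic, arXiv:0804.2860, doi:10.2140/ant.2012.6.405, arXiv:1507.05032,
Literature.Barriers.Langlands.NonRegularWeightBarrier]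
#3 NonLimitIrregularAutomorphy (crux) — [crux] NL_TR — NON-REGULARIZABLE AND NO HOLOMORPHIC-LIMIT
MOVE (child 2/3 of IRR*_TR 31691; DECLARED RESIDUAL of the split = the dark core of weak reciprocity
over totally real fields; WEAKER than IRR*_TR outright — one more hypothesis —, kernel
`nonLimit_of_nonRegularizable`; Langlands-implied): for every TOTALLY REAL K, n ≥ 1, hcpt, (ℓ, ι)
and every irreducible geometric ρ over K admitting NO regularizing move (¬MOVE(ρ/K), verbatim the
parent's saturated dial) AND NO HOLOMORPHIC-LIMIT MOVE — ¬LIMMOVE(ρ/K): there are no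
conjugation-solvable M ⊇ K (w.r.t. K and w.r.t. a totally real F₁), irreducible constituent θ of ρ|M
(rank ≥ 1, at trace level), character χ of Γ_M and irreducible geometric R′ over F₁ of RANK ≤ 4 with
a TOTALLY ODD-SIGNED POLARIZATION and ALL LABELLED HT MULTIPLICITIES ≤ 2 such that θ ⊗ χ is a
constituent of R′|M (LIMMOVE = the parent's MOVE template with «R′ HT-regular» replaced by «R′ of
holomorphic-limit type»; saturated by construction) —, ρ is weakly automorphic. CONTENT (why it is
dark): EVEN representations — even icosahedral Artin ρ_e (AT1: its only polarization is alt, μ =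
det, μ(c) = +1) and everything tensored from it: the multiplicity-≤-2 avatars of ρ_e are ρ_e|F₁ ⊗ τ
with τ a REGULAR constituent of a potentially abelian representation over a conjugation-solvable
layer, hence MONOMIAL from a totally imaginary field (Clifford + regularity), and every polarization
of such a τ is totally odd by the conjugate-block computation (= Bellaïche–Chenevier 2011 Thm 1.2 /
Taylor 2012 in the automorphic case), while the polarizations of ρ_e ⊗ τ are alt_e ⊗ pol(τ) with the
OPPOSITE sign (A₅ does not die in a solvable extension, so Ad⁰ρ_e contributes nothing) ⇒ ρ_e ⊗ τ is
totally EVEN; MULTIPLICITY ≥ 3 or RANK ≥ 5 — Artin of rank ≥ 3 (any parity), abelian g-folds g ≥ 3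
with large monodromy (census AT15 `Res E₈₉` re-homed here: multiplicity 3), Calabi–Yau threefolds
with h²'¹ ≥ 2, K3-type / orthogonal weight-2 motives (Gross 2016: no discrete series, not
Shimura-standard); NON-POLARIZABLE irregular ρ; mixed-parity rank 2 (conjecturally empty). Print
inside, not a leak (Sym-powers lie outside the transport cone): Sym²/Sym³ of odd weight-one forms.
Barriers `Literature.Barriers.Langlands.NonRegularWeightBarrier`, `ShimuraVarietyRealization` bite
BY DESIGN. lens-5-g7's REST ⊇ this cell ∪ (HL_TR ∖ rank 2). [difficulty: open-problem] [difficulty: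
open-problem] (why it might fail: It IS the dark core: even icosahedral Artin (nothing since
Langlands–Tunnell), rank ≥ 3 Artin, abelian g ≥ 3-folds, CY/K3-type irregular motives over totally
real fields — no Shimura realization, no limit of discrete series, no p-adic glueing; the typed
summit may fail here first.) [Calegari2011EvenFM, arXiv:0804.2860, doi:10.2140/ant.2012.6.405,
BuzzardGee2014, Literature.Barriers.Langlands.NonRegularWeightBarrier,
Literature.Barriers.Langlands.ShimuraVarietyRealization,
Literature.Barriers.Langlands.SolvableImageBarrier, arXiv:2109.14145]
#4 ConjugationInsolubleAutomorphy (crux) — B_CI (parent item stmt-Langlands-31692 VERBATIM, shared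
by dedup; the parent's DECLARED RESIDUAL #2): for every number field K lying in NO solvable Galois
extension of a totally real field, every irreducible geometric ρ : Γ_K → GL_n(ℚ̄_ℓ) is weakly
automorphic. [difficulty: open-problem] [difficulty: open-problem] (why it might fail: no
construction of Galois representations, no Shimura variety and no solvable path to one over such K;
simple-group base change for GL_n is wide open (Getz); nothing beyond n = 1 and solvable-image Artin
is decided.) [ArthurClozelAMS120, Rajan2002, Getz2012,
Literature.Barriers.Langlands.ShimuraVarietyRealizationBarrier]
#5 RegularTotallyRealAutomorphy (crux) — REG_TR (parent item stmt-Langlands-31693 VERBATIM, shared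
by dedup; the parent's ATTACKABLE leaf): for every totally real K and every irreducible geometric ρ
: Γ_K → GL_n(ℚ̄_ℓ) whose labelled Hodge–Tate weights are distinct at every v ∣ ℓ and every label, ρ
is weakly automorphic. [difficulty: open-problem] [difficulty: open-problem] (why it might fail:
residual automorphy (Serre-type conjectures over totally real fields, GSp₄ and beyond) and
non-polarizable regular ρ of rank ≥ 3 have no engine; Fontaine–Mazur for GL₂ is complete only over ℚ
and only for ℓ ≥ 5 generic residual image.) [Kisin2009FM, arXiv:1901.07166, Calegari2011EvenFM,
BarnetlambEtAl2014, arXiv:1812.09269]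
#6 SatakeAvatarExistence (crux) — W⁺ (N0 item stmt-Langlands-17415 VERBATIM, shared by dedup) — for
every number field K, n ≥ 1, every L-algebraic cuspidal π of GL_n(𝔸_K) and every (ℓ, ι) there is an
IRREDUCIBLE ρ : Γ_K → GL_n(ℚ̄_ℓ) Satake–Frobenius compatible with (π, ι) at almost all places; also
the inlined first hypothesis of S1, S2, MT. [difficulty: open-problem] [difficulty: open-problem]
(why it might fail: no construction of ρ for irregular L-algebraic π (Maass λ = ¼, non-cohomological
weights) or for K neither totally real nor CM; irreducibility open for n ≥ 3 outside polarized /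
density-one cases.) [BuzzardGee2014, HarrisLanTaylorThorneRMS2016, Scholze2015]
#7 PadicMemberCompatibility (crux) — P (N0 item stmt-Langlands-17534 VERBATIM, shared by dedup) —
for every K, n ≥ 1, L-algebraic cuspidal π, (ℓ, ι) and irreducible ρ Satake–Frobenius compatible
with (π, ι) a.e.: at every place v over ℓ, ρ|Γ_v is de Rham (pinned period ring) and its
Weil–Deligne representation matches rec_v(π_v) through the reciprocity datum. [difficulty:
open-problem] [difficulty: open-problem] (why it might fail: local–global compatibility at v ∣ ℓ for
non-polarizable π over general K is known only up to semisimplification/monodromy in the CM case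
(ACC+, torsion classes); de Rhamness of ρ_π at ℓ open for irregular π.) [ACC2023, Caraiani2014,
BarnetlambEtAl2014, arXiv:2109.14145]
#8 CompatibilityAwayFromLR (crux) — L∤R (N0 item stmt-Langlands-18084 VERBATIM, shared by dedup) —
for every K, reciprocity datum, n ≥ 1, L-algebraic cuspidal π, (ℓ, ι), irreducible ρ
Satake–Frobenius compatible with (π, ι) a.e., and every place v NOT over ℓ: full local–global
compatibility of the Weil–Deligne representation of ρ|Γ_v with rec_v(π_v). [difficulty:
open-problem] [difficulty: open-problem] (why it might fail: away from ℓ the monodromy operator N is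
not known to match for non-polarizable π over CM K (compatibility up to Frobenius-semisimplification
and N only in print), and nothing is known for K neither TR nor CM.) [ACC2023, Varma2024,
TaylorYoshida2007, arXiv:2109.14145]
#9 LimitMoveTransport (support) — [support] LMT — HOLOMORPHIC-LIMIT MOVE TRANSPORT (child 3/3 of
IRR*_TR 31691, the SEAM of the split; WEAKER than MT ∘ W⁺: kernel
`limitMoveTransport_of_moveTransport : SatakeAvatarExistence → RegularizingMoveTransport →
LimitMoveTransport`, i.e. it closes the moment MT 31697 and W⁺ 17415 close; Langlands-implied,
kernel `limitMoveTransport_of_weak`): the parent's move transport `RegularizingMoveTransport` with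
the W⁺ prefix DROPPED and the extra hypotheses «F₁ totally real», «rank R′ ≤ 4», «R′ totally
odd-signed polarizable», «labelled HT multiplicities of R′ ≤ 2», «R′ not HT-regular» ADDED: for R
irreducible geometric over F₀, M conjugation-solvable w.r.t. F₀ (via E₀) and w.r.t. the totally real
F₁ (via E₁), θ an irreducible trace-constituent of R|M of rank ≥ 1, χ a character of Γ_M and R′ over
F₁ of holomorphic-limit type with θ ⊗ χ a trace-constituent of R′|M: weak automorphy of R′ over F₁
(for every compact-level witness) ⇒ weak automorphy of R over F₀. Print route: R′ automorphic ⇒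
(solvable Galois ascent along E₁/F₁, Arthur–Clozel III.4.2/III.5.1 + Clifford + Brauer–Nesbitt with
the Satake avatars) θχ automorphic over M ⇒ (χ algebraic by CFT/Weil; untwist) θ automorphic ⇒
(ascent along E₀/M then Clifford solvable descent along E₀/F₀, AC III.6.2) R automorphic. NOT used
by `closes` directly: it is consumed by the glue `NonRegularizableAutomorphy_of_hlsplit`.
[difficulty: M] [deps: RegularizingMoveTransport, SatakeAvatarExistence] [difficulty: M] (why it
might fail: Only via the transport: Arthur–Clozel ascent/descent along the solvable layers needs the
Satake avatars W⁺ (17415) for the Brauer–Nesbitt matching of constituents over conjugation-solvable,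
possibly non-CM fields; it closes from MT 31697 ∧ W⁺, not from print alone.) [ArthurClozelAMS120,
BuzzardGee2014, arXiv:0804.2860]
#9 SolvableGaloisAscent (support) — S1 (parent item stmt-Langlands-31694 VERBATIM, shared by dedup)
— solvable Galois ascent of weak automorphy to an irreducible constituent (PRINT given W⁺, inlined:
Arthur–Clozel III.4.2/III.5.1 + Clifford + Brauer–Nesbitt). [difficulty: L] [difficulty: L]
[ArthurClozelAMS120, BuzzardGee2014]
#9 CliffordSolvableDescent (support) — S2 (parent item stmt-Langlands-31695 VERBATIM, shared by
dedup) — Clifford solvable descent of weak automorphy from one constituent over a solvable Galois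
extension (PRINT given W⁺, inlined: Clifford dichotomy, Arthur–Clozel III.4.2(b)/III.6, automorphic
induction). [difficulty: L] [difficulty: L] [ArthurClozelAMS120, Henniart2012AI, Rajan2002]
#9 WeilRestrictionConstituent (support) — S3 (parent item stmt-Langlands-31696 VERBATIM, shared by
dedup) — the Weil-restriction constituent: pure algebra + geometric heredity, PROVABLE NOW (tree
`FramedGaloisRep.induce`, `isDeRhamFramed_fontainePst_induce`, block heredity). [difficulty: M]
[difficulty: M] [SerreLinearRepresentations1977, FontaineAsterisque223III, BrinonConrad2009]
#9 RegularizingMoveTransport (support) — MT (parent item stmt-Langlands-31697 VERBATIM, shared by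
dedup) — transport of weak automorphy back along one move (PRINT given W⁺, inlined; = S1 ∘ twist ∘
S2 bookkeeping; no regularity hypothesis used, so it also feeds LMT). [difficulty: M] [difficulty:
M] [ArthurClozelAMS120, SerreAbelianLadic1968, HarrisSoudryTaylor1993]
#9 CanonicalReciprocityData (support) — CRD (N0 item stmt-Langlands-17930 VERBATIM, shared by
dedup): every number field carries a reciprocity datum (local Langlands for GL_n at every place,
packaged). [difficulty: M] [difficulty: M] [HarrisTaylor2001]

TWO-LAYER PLAN. Layer 1 (this route): IRR*_TR = HL_TR ∧ NL_TR modulo LMT (kernel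
`nonRegularizable_of_split`; exact one level up, `totallyReal_iff_pieces₃`). Foreseen glued
splits, NOT filed now: HL_TR by rank — «n = 2 (weight one ∪ partial weight one: lens-5-g7's
OA/OB/PW1 live here)» / «n = 4 symplectic (abelian surfaces,
GSp₄ (k,2))» / «n = 4 orthogonal (GO₄)» — each box orbit-closed under the transports that preserve
rank; NL_TR stays whole (declared residual) unless a
prover exhibits an engine for one of its named families (Sym-power shadows are already print and
outside the cone).

KILL CRITERIA. A LEAK kills the split (not the cells): a print derivation of an NL_TR instance from
HL_TR ∪ REG_TR by solvable base change / automorphic induction /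
twisting alone — first suspects ρ_even ⊗ τ (refuted at sketch level: totally even for every
admissible τ, see Why this line) and Weil restrictions of
partial-weight-one forms (inside HL by a limit move, as designed). A refutation of LMT AS TYPED
(e.g. an L-algebraicity slip under untwisting) is repaired by
retyping the support; HL_TR / NL_TR are Langlands-implied (`children_of_langlands`): refuting one
refutes the typed summit.

NOT DECOMPOSED YET. NL_TR is the declared residual, deliberately un-split (its natural sub-families
— even Artin, multiplicity ≥ 3, rank ≥ 5, non-polarizable — have no engine
and no orbit-closed typing finer than the dial itself has been certified). HL_TR is served whole;
the rank boxes of the Two-layer plan are attached by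
`--split` only on a prover's request. The parent's B_CI / REG_TR / supports are inherited verbatim
and not touched here.

CHEAPEST FALSIFIER. ONE irreducible geometric ρ over a totally real F with ¬MOVE(ρ) ∧ ¬LIMMOVE(ρ)
whose weak automorphy follows IN PRINT from HL_TR ∪ REG_TR instances by the
route's own transports (solvable Galois ascent/descent, twists, constituents) — a leak of the
saturated limit dial. Finite-group version (kit-able, GAP, ≤ 1
core-h, census F151 instrument): for the icosahedral and octahedral Artin representations of small
conductor over ℚ and real quadratic fields, tabulate
rank ≤ 4 tensor/induction avatars with the SIGN of each polarization under every complex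
conjugation; any even ρ with an odd-signed multiplicity-≤-2 avatar
of rank ≤ 4 falsifies the sketch-level darkness argument (prediction: none — alt ⊗ odd = even).

NUMBERS. items 14 (cruxes 7: HL_TR r2, NL_TR r3, B_CI r4, REG_TR r5, W⁺ r6, P r7, L∤R r8; supports
6: LMT, S1, S2, S3, MT, CRD; assembly 1); NEW decls 3 (HL_TR 2386
chars, NL_TR 6406, LMT 4634); EQUIV 0 new (the split is WEAKER ⟹ parent by pure logic; exactness
certified one level up); kernels 10 new (node file 322
lines, 0 sorry, axioms {propext, Classical.choice, Quot.sound} by #guard_msgs); probes: C →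
Langlands / C → B_w / C → IRR*_TR FAIL 36/36, `example : C := by
exact?` FAIL 6/6, IRR*_TR → HL_TR FAIL 4/4 (HL is a sub-cell of B_TR, not of IRR*: it contains
movable Weil restrictions — harmless, exactness at B_TR level),
IRR*_TR → NL_TR ELABORATES (sub-cell); bc7 HL CLEAN · NL CLEAN · LMT CLEAN [P3 timeout, support].
BC1 cone: 7 open cruxes among 13 binders = WARN (one
thesis = the holomorphic-limit dial on ONE node; five open cruxes are the parent's verbatim). Rank 3
part of HL provably vacuous (odd-dimensional
irreducible polarized ρ is orthogonal up to twist with weights symmetric ⇒ multiplicity pattern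
forces regular or multiplicity 3).
currency: rung 0 (residual mode: certified split of a declared residual; theorem-grade boxes inside
HL cited by name, not re-typed).

DEFINITION REQUESTS. None: the sign is typed on matrices (`Matrix.transpose`, similitude scalar,
`IsComplexConjugation φ c` from Literature.NumberTheory.GaloisRepresentations),
multiplicities by `Multiset.count w (ρ.labelledHodgeTateWeightsAt v … τ) ≤ 2`, the move template
verbatim from the parent. A Theorems-side lemma provers
will want once: «a polarization of an absolutely irreducible ρ is unique up to scalar and is
symmetric or alternating» (Schur), to pass between the matrix
typing and the BLGGT (r, μ) language of the cited facts.

Novelty: Searches RUN: tree `rg "transpose|IsComplexConjugation|IsOdd|labelledHodgeTateWeightsAt|count"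
lean/Summits/Langlands` (hits: ParityLadder's `FramedGaloisRep.IsOdd`
= det ρ(c) = −1 in rank 2 and its trace-parity dial; RootDecomp1/lens-2 multiplicity dial
`WeightMultiplicitySplit` on the ROOT; no polarization SIGN anywhere in
Theses); `ledger negatives --problem Langlands` (4 entries, none on polarizations or limits of
discrete series); cell bus L300–L458 (lens-5-g7 WeightOneBridgeSplit
on the same node: rank 2 ∧ IsOdd × finite image / HT-scalar / partial weight one — declared
collision L454; lens-1-g9 on W⁺; lens-2-g8 Steinberg shadow;
lens-6 PD carving; lens-4 dyadic level one); corpus `lit search --hybrid "sign of Galois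
representations polarization totally odd"` → [corpus:paper:arxiv-0804.2860
p.2 Thm 1.2, p.3] Bellaïche–Chenevier, [corpus:paper:doi-10-2140-ant-2012-6-405] Taylor; `lit search
"higher Hida theory coherent cohomology GSp4"` →
BCGP arXiv:1812.09269, Pilloni 2020, Boxer–Pilloni; `lit galaxy search "limits of discrete
series|higher Coleman|partial weight one" --star all` → Goldring–Koskivirta
arXiv:1507.05032 (strata Hasse invariants / LDS reach), Diamond–Kassaei–Sasaki (partial weight one),
no decomposition of reciprocity by the LDS condition found.
Nearest prior art FOUND: lens-5-g7 WeightOneBridgeSplit (same parent; rank-2 odd sub-boxes,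
theorem-grade OA by name) and lens-2 WeightMultiplicitySplit
(multiplicity ≤ 2 on the root, no sign, no rank bound); in pr  [refs: 1812.09269, 1507.05032, paper:arxiv-0804.2860, paper:doi-10-2140-ant-2012-6-405]

Barriers (technique_class: holomorphic-LDS, higher-hida, polarization-sign): - technique_class: holomorphic-limit-of-discrete-series, higher-hida-theory, weight-one-glueing,
polarization-sign, weil-restriction
- Literature.Barriers.Langlands.NonRegularWeightBarrier: HL_TR sits INSIDE the barrier's class but
exactly on the part breached in print (limits of discrete series: coherent cohomology in degrees
0/1, weight-one glueing, higher Hida theory — the barrier theorem's hypothesis «no geometric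
realisation of the Hecke eigensystem» fails there); NL_TR is the barrier's hard core and is DECLARED
RESIDUAL — the bet is none: the route isolates it, it does not pretend to attack it.
- Literature.Barriers.Langlands.ShimuraVarietyRealizationBarrier: EVADED on HL_TR by the rank ≤ 4 ∧
odd-sign ∧ multiplicity ≤ 2 typing (precisely the representations expected in coherent cohomology of
Hilbert / Siegel-GSp₄ / GO₄ Shimura varieties over totally real fields); BITES on NL_TR (rank ≥ 5
irregular symplectic/orthogonal motives, even ρ: no Shimura datum — Gross 2016) by design.
- Literature.Barriers.Langlands.SolvableImageBarrier: not in play for HL/NL (infinite or insoluble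
image); the solvable-image Artin members are already decided (Langlands–Tunnell) and sit in
whichever cell their sign puts them, harmlessly.
- Literature.Barriers.Langlands.SolvableImageBarrierNarrow: `SolvableImageBarrierNarrow_holds` — met
honestly, as on the parent WeilRestrictionSplit: every base change / descent / induction in this
cone (LMT, S1, S2, MT) runs along SOLVABLE GALOIS layers only (A

sub-problem: Langlands · status: draft · opened planner-decomp-langlands-writer-1-g3-0 2026-08-30T10:20:41Z · rev 2 · ledger route-Langlands-HolomorphicLimitSplit
GENERATED by the gate from the ledger (D-0016/17). Provers cite these decls: `theorem foo : Summit.Langlands.Langlands.Theses.HolomorphicLimitSplit.<Decl> := …` in Summits/Langlands/Langlands/Theorems/<Name>.lean.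
-/

namespace Summit.Langlands.Langlands.Theses.HolomorphicLimitSplit

open scoped BigOperators Topology Manifold Classical MeasureTheory ProbabilityTheory Matrix InnerProductSpace ComplexConjugate ContinuousMap
open Filter Set Function TopologicalSpace MeasureTheory

attribute [summit_statement] _root_.Langlands

/-- item stmt-Langlands-32003 · crux · rank 2 · SPLIT (gen 1) into OddArtinTypeAutomorphy, OddWeightOneBridgeAutomorphy, PrimitivePartialWeightOneAutomorphy, LowRankDihedralLimitAutomorphy, RankFourModRankTwoAutomorphy + glue HolomorphicLimitAutomorphy_of_wsplit · direct attempts still welcome (low priority) · by planner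
why it might fail: Beyond totally odd weight one (KW, Pilloni–Stroh, Sasaki) and abelian surfaces / GSp₄ (k,2) under residual-image hypotheses (BCGP) no engine: partial weight one in general, small residual image, p = 2, GO₄ only via Ramakrishnan; higher Coleman theory gives overconvergent, not classical, limits.
sources: arXiv:1812.09269, BoxerCalegariGeePilloni2025, Literature.NumberTheory.DiophantineGeometry.bcgp2025_modThreeSurjective_modular_abelianSurface, PilloniStroh2016Asterisque, Literature.NumberTheory.Automorphic.pilloniStroh_strongArtin_of_isIcosahedralType, KhareWintenberger2009
[crux] HL_TR — HOLOMORPHIC-LIMIT AUTOMORPHY over totally real fields (child 1/3 of IRR*_TR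
`NonRegularizableAutomorphy` 31691; ATTACKABLE-BY-ENGINE; WEAKER than B_TR = B_w over totally real
K, kernel `holomorphicLimit_of_weak`; Langlands-implied): for every TOTALLY REAL K, 1 ≤ n ≤ 4, hcpt,
(ℓ, ι) and every irreducible geometric ρ : Γ_K → GL_n(ℚ̄_ℓ) which (i) carries a TOTALLY ODD-SIGNED
POLARIZATION — a nondegenerate symmetric-or-alternating matrix B on which Γ_K acts through ρ by
similitudes (ρ(g)ᵀ B ρ(g) = s(g)·B) and such that B·ρ(c) is SYMMETRIC for EVERY complex conjugation
c of K (the Bellaïche–Chenevier / BLGGT sign ε(B)μ(c_v) = +1 at all real places, typed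
convention-free on matrices) —, (ii) has every labelled Hodge–Tate weight of multiplicity ≤ 2 (at
every v ∣ ℓ, every label), and (iii) is NOT Hodge–Tate regular, ρ is weakly automorphic (cuspidal
L-algebraic π on GL_n(𝔸_K), Satake–Frobenius compatible a.e.). This is the Galois-side description
of the HOLOMORPHIC LIMIT-OF-DISCRETE-SERIES sector = what degree-0/1 COHERENT cohomology of the PEL
Shimura varieties of GL₂/F, GSp₄/F ≅ GSpin₅, GO₄ reaches (rank ≤ 4 = accidental-isomorphism range;
Goldring–Koskivirta: multiplicity -/
@[route_item "route-Langlands-HolomorphicLimitSplit", crux]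
def HolomorphicLimitAutomorphy : Prop :=
  ∀ (K : Type) [Field K] [NumberField K], NumberField.IsTotallyReal K → ∀ (n : ℕ) (hcpt : Literature.NumberTheory.Automorphic.isCompact_glFiniteIntegralLevel n K), 0 < n → ∀ (ℓ : ℕ) [Fact ℓ.Prime] (ι : PadicAlgCl ℓ ≃+* ℂ) (ρ : Literature.NumberTheory.GaloisRepresentations.FramedGaloisRep K (PadicAlgCl ℓ) n), ρ.toGaloisRep.IsIrreducible → ((∀ᶠ v : IsDedekindDomain.HeightOneSpectrum (NumberField.RingOfIntegers K) in Filter.cofinite, ρ.IsUnramifiedAt v) ∧ ∀ (v : IsDedekindDomain.HeightOneSpectrum (NumberField.RingOfIntegers K)) (hv : ((ℓ : ℕ) : NumberField.RingOfIntegers K) ∈ v.asIdeal), (Literature.NumberTheory.PAdicHodge.fontainePstAdicCompletion v ℓ hv).IsDeRhamFramed (ρ.toLocal v)) → n ≤ 4 → (∃ B : Matrix (Fin n) (Fin n) (PadicAlgCl ℓ), B.det ≠ 0 ∧ (Matrix.transpose B = B ∨ Matrix.transpose B = -B) ∧ (∀ g : Field.absoluteGaloisGroup K, ∃ s : PadicAlgCl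 ℓ, Matrix.transpose ((ρ g : GL (Fin n) (PadicAlgCl ℓ)) : Matrix (Fin n) (Fin n) (PadicAlgCl ℓ)) * B * ((ρ g : GL (Fin n) (PadicAlgCl ℓ)) : Matrix (Fin n) (Fin n) (PadicAlgCl ℓ)) = s • B) ∧ ∀ (φ : K →+* ℝ) (c : Field.absoluteGaloisGroup K), Literature.NumberTheory.GaloisRepresentations.IsComplexConjugation φ c → Matrix.transpose (B * ((ρ c : GL (Fin n) (PadicAlgCl ℓ)) : Matrix (Fin n) (Fin n) (PadicAlgCl ℓ))) = B * ((ρ c : GL (Fin n) (PadicAlgCl ℓ)) : Matrix (Fin n) (Fin n) (PadicAlgCl ℓ))) → (∀ (v : IsDedekindDomain.HeightOneSpectrum (NumberField.RingOfIntegers K)) (hv : ((ℓ : ℕ) : NumberField.RingOfIntegers K) ∈ v.asIdeal), ∀ τ : v.adicCompletion K →+* PadicAlgCl ℓ, Continuous τ → ∀ w : ℤ, Multiset.count w (ρ.labelledHodgeTateWeightsAt v (Literature.NumberTheory.PAdicHodge.fontainePstAdicCompletion v ℓ hv).algebra (Literature.NumberTheory.PAdicHodge.fontainePstAdicCompletion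 v ℓ hv).𝔅 τ) ≤ 2) → ¬ (∀ (v : IsDedekindDomain.HeightOneSpectrum (NumberField.RingOfIntegers K)) (hv : ((ℓ : ℕ) : NumberField.RingOfIntegers K) ∈ v.asIdeal), ∀ τ : v.adicCompletion K →+* PadicAlgCl ℓ, Continuous τ → (ρ.labelledHodgeTateWeightsAt v (Literature.NumberTheory.PAdicHodge.fontainePstAdicCompletion v ℓ hv).algebra (Literature.NumberTheory.PAdicHodge.fontainePstAdicCompletion v ℓ hv).𝔅 τ).Nodup) → ∃ π : Literature.NumberTheory.Automorphic.CuspidalAutomorphicRepData n K hcpt, π.1.IsLAlgebraic ∧ ∀ᶠ v : IsDedekindDomain.HeightOneSpectrum (NumberField.RingOfIntegers K) in Filter.cofinite, SatakeFrobCompatibleAt ι π.1 ρ v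

-- parent: HolomorphicLimitAutomorphy · child (gen 1)
/--     item stmt-Langlands-32990 · crux · rank 202 · open
    parent: HolomorphicLimitAutomorphy · by planner
    why it might fail: As typed OB is the finite-image half of Fontaine–Mazur in parallel weight one over EVERY totally real F: open for ℓ = 2, for ρ̄ not Taylor–Wiles-generic, for p ramified in F / non-p-distinguished ρ; every print engine (Buzzard–Taylor, Kassaei, Pan, CG) needs residual modularity.
    sources: Pan2022LocallyAnalytic, Literature.NumberTheory.Automorphic.Pan2022_fontaineMazurGL2_weightOne, Calegari2018NonMinimalWeightOne, Literature.NumberTheory.Automorphic.Calegari2018_weightOneLifting_unramifiedAtP, arXiv:1204.0579, Kassaei2011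
[crux] OB — ODD WEIGHT-ONE BRIDGE (child 2/5 of HL_TR stmt-Langlands-32003 — lens-5 g7 «bridge»;
ATTACKABLE; WEAKER than HL_TR, kernel `pieces_of_hl`; Langlands-implied): HL_TR's box with n = 2, ρ
totally odd, ρ HT-SCALAR (at every v ∣ ℓ and every label τ all labelled Hodge–Tate weights coincide
— verbatim the dial of ParityLadder 29751; in rank 2: parallel weight one up to twist) and NOT of
finite projective image ⟹ ρ weakly automorphic. «Vanishing in disguise»: the finite-image half of
Fontaine–Mazur over totally real fields (a totally odd irreducible geometric rank-2 ρ with all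
labelled weights equal has finite projective image) says this box is EMPTY, and emptiness ⟹ OB
(kernel `bridge_of_finiteness : OddWeightOneFiniteness → OB`); it is the BRIDGE that carries the
decided Artin range OA to the whole HT-scalar odd rank-2 locus (kernel `Cert.scalarLocus_of_OA_OB`).
CERTIFIED RUNGS (kernel theorems, summit vocabulary, NAMED tree facts): over ℚ, ℓ odd, ρ̄|Γ_ℚ(ζ_ℓ)
absolutely irreducible, residually generic at ℓ, HT weights {0,0} — `ratRung_of_Pan2022 :
Pan2022_fontaineMazurGL2_weightOne → RatWeightOneRung` (Pan 2022 Thm 1.0.5) and `ratRung_of_pieces :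
OA → OB → RatWeightOneRung`; -/
@[route_item "route-Langlands-HolomorphicLimitSplit"]
def OddWeightOneBridgeAutomorphy : Prop :=
  ∀ (K : Type) [Field K] [NumberField K], NumberField.IsTotallyReal K → ∀ (n : ℕ) (hcpt : Literature.NumberTheory.Automorphic.isCompact_glFiniteIntegralLevel n K), 0 < n → ∀ (ℓ : ℕ) [Fact ℓ.Prime] (ι : PadicAlgCl ℓ ≃+* ℂ) (ρ : Literature.NumberTheory.GaloisRepresentations.FramedGaloisRep K (PadicAlgCl ℓ) n), ρ.toGaloisRep.IsIrreducible → ((∀ᶠ v : IsDedekindDomain.HeightOneSpectrum (NumberField.RingOfIntegers K) in Filter.cofinite, ρ.IsUnramifiedAt v) ∧ ∀ (v : IsDedekindDomain.HeightOneSpectrum (NumberField.RingOfIntegers K)) (hv : ((ℓ : ℕ) : NumberField.RingOfIntegers K) ∈ v.asIdeal), (Literature.NumberTheory.PAdicHodge.fontainePstAdicCompletion v ℓ hv).IsDeRhamFramed (ρ.toLocal v)) → n ≤ 4 → (∃ B : Matrix (Fin n) (Fin n) (PadicAlgCl ℓ), B.det ≠ 0 ∧ (Matrix.transpose B = B ∨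 Matrix.transpose B = -B) ∧ (∀ g : Field.absoluteGaloisGroup K, ∃ s : PadicAlgCl ℓ, Matrix.transpose ((ρ g : GL (Fin n) (PadicAlgCl ℓ)) : Matrix (Fin n) (Fin n) (PadicAlgCl ℓ)) * B * ((ρ g : GL (Fin n) (PadicAlgCl ℓ)) : Matrix (Fin n) (Fin n) (PadicAlgCl ℓ)) = s • B) ∧ ∀ (φ : K →+* ℝ) (c : Field.absoluteGaloisGroup K), Literature.NumberTheory.GaloisRepresentations.IsComplexConjugation φ c → Matrix.transpose (B * ((ρ c : GL (Fin n) (PadicAlgCl ℓ)) : Matrix (Fin n) (Fin n) (PadicAlgCl ℓ))) = B * ((ρ c : GL (Fin n) (PadicAlgCl ℓ)) : Matrix (Fin n) (Fin n) (PadicAlgCl ℓ))) → (∀ (v : IsDedekindDomain.HeightOneSpectrum (NumberField.RingOfIntegers K)) (hv : ((ℓ : ℕ) : NumberField.RingOfIntegers K) ∈ v.asIdeal), ∀ τ : v.adicCompletion K →+* PadicAlgCl ℓ, Continuous τ → ∀ w : ℤ, Multiset.count w (ρ.labelledHodgeTateWeightsAt v (Literature.NumberTheory.PAdicHodge.fontainePstAdicCompletion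 v ℓ hv).algebra (Literature.NumberTheory.PAdicHodge.fontainePstAdicCompletion v ℓ hv).𝔅 τ) ≤ 2) → ¬ (∀ (v : IsDedekindDomain.HeightOneSpectrum (NumberField.RingOfIntegers K)) (hv : ((ℓ : ℕ) : NumberField.RingOfIntegers K) ∈ v.asIdeal), ∀ τ : v.adicCompletion K →+* PadicAlgCl ℓ, Continuous τ → (ρ.labelledHodgeTateWeightsAt v (Literature.NumberTheory.PAdicHodge.fontainePstAdicCompletion v ℓ hv).algebra (Literature.NumberTheory.PAdicHodge.fontainePstAdicCompletion v ℓ hv).𝔅 τ).Nodup) → n = 2 → ρ.IsOdd → (∀ (v : IsDedekindDomain.HeightOneSpectrum (NumberField.RingOfIntegers K)) (hv : ((ℓ : ℕ) : NumberField.RingOfIntegers K) ∈ v.asIdeal), ∀ τ : v.adicCompletion K →+* PadicAlgCl ℓ, Continuous τ → ∀ a ∈ ρ.labelledHodgeTateWeightsAt v (Literature.NumberTheory.PAdicHodge.fontainePstAdicCompletion v ℓ hv).algebra (Literature.NumberTheory.PAdicHodge.fontainePstAdicCompletion v ℓ hv).𝔅 τ, ∀ b ∈ ρ.labelledHodgeTateWeightsAt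 v (Literature.NumberTheory.PAdicHodge.fontainePstAdicCompletion v ℓ hv).algebra (Literature.NumberTheory.PAdicHodge.fontainePstAdicCompletion v ℓ hv).𝔅 τ, a = b) → ¬ (∃ (L : Type) (_ : Field L) (_ : NumberField L) (_ : Algebra K L), ∀ σ : Field.absoluteGaloisGroup L, ∃ c : PadicAlgCl ℓ, ((ρ.restrictField L σ : GL (Fin n) (PadicAlgCl ℓ)) : Matrix (Fin n) (Fin n) (PadicAlgCl ℓ)) = c • (1 : Matrix (Fin n) (Fin n) (PadicAlgCl ℓ))) → ∃ π : Literature.NumberTheory.Automorphic.CuspidalAutomorphicRepData n K hcpt, π.1.IsLAlgebraic ∧ ∀ᶠ v : IsDedekindDomain.HeightOneSpectrum (NumberField.RingOfIntegers K) in Filter.cofinite, SatakeFrobCompatibleAt ι π.1 ρ v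

-- parent: HolomorphicLimitAutomorphy · child (gen 1)
/--     item stmt-Langlands-32991 · crux · rank 203 · open
    parent: HolomorphicLimitAutomorphy · by planner
    why it might fail: No engine: non-dihedral partial weight one forms sit in coherent H⁰/H¹ of Hilbert modular varieties with l₀ > 0, admit no overconvergent-to-classical glueing and no Taylor–Wiles patching; residual modularity over F ≠ ℚ is itself open; not even potential automorphy is in print.
    sources: Jarvis1997, Newton2015LowWeight, Literature.NumberTheory.Automorphic.exists_galoisRep_GL2_totallyReal_partialWeightOne, DiamondSasaki2025, CalegariGeraghty2018, BuzzardDiamondJarvis2010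
[crux] PW1♯ — PRIMITIVE PARTIAL WEIGHT ONE (child 3/5 of HL_TR stmt-Langlands-32003 — lens-5 g7 v3;
DECLARED RESIDUAL #1 of the split; IDEA-NEEDED; meets
Literature.Barriers.Langlands.NonRegularWeightBarrier and .TaylorWilesNumericalCoincidence head-on;
WEAKER than HL_TR, kernel `sharp_of_hl`; Langlands-implied, `Cert.sharp_of_langlands`): HL_TR's box
with n = 2, ρ totally odd, NOT HT-scalar, NOT of finite projective image and QUADRATICALLY PRIMITIVE
— ρ|Γ_L irreducible for EVERY quadratic extension L/K (literal `∀ L, finrank K L = 2 →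
(ρ.restrictField L).toGaloisRep.IsIrreducible`; for infinite projective image this is Lie(proj.
image) = 𝔰𝔩₂, i.e. non-dihedral; saturated under twists and finite base change / descent, and no
automorphic-induction image from GL₁ lands here) ⟹ ρ weakly automorphic. This is EXACTLY the
NON-DIHEDRAL partial weight one Hilbert type over totally real K ≠ ℚ (over ℚ the box is empty: one
place above ℓ, one label); the dihedral island (ρ ≅ Ind_L^K ψ, L/K CM quadratic, ψ of mixed infinity
type — theta series, automorphic by Jacquet–Langlands §12; critic b1, CRITIC-LEDGER row 109) is
BOOKED in the sibling LOW♭, so PW1♯ contains no instance known to be automor -/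
@[route_item "route-Langlands-HolomorphicLimitSplit"]
def PrimitivePartialWeightOneAutomorphy : Prop :=
  ∀ (K : Type) [Field K] [NumberField K], NumberField.IsTotallyReal K → ∀ (n : ℕ) (hcpt : Literature.NumberTheory.Automorphic.isCompact_glFiniteIntegralLevel n K), 0 < n → ∀ (ℓ : ℕ) [Fact ℓ.Prime] (ι : PadicAlgCl ℓ ≃+* ℂ) (ρ : Literature.NumberTheory.GaloisRepresentations.FramedGaloisRep K (PadicAlgCl ℓ) n), ρ.toGaloisRep.IsIrreducible → ((∀ᶠ v : IsDedekindDomain.HeightOneSpectrum (NumberField.RingOfIntegers K) in Filter.cofinite, ρ.IsUnramifiedAt v) ∧ ∀ (v : IsDedekindDomain.HeightOneSpectrum (NumberField.RingOfIntegers K)) (hv : ((ℓ : ℕ) : NumberField.RingOfIntegers K) ∈ v.asIdeal), (Literature.NumberTheory.PAdicHodge.fontainePstAdicCompletion v ℓ hv).IsDeRhamFramed (ρ.toLocal v)) → n ≤ 4 → (∃ B : Matrix (Fin n) (Fin n) (PadicAlgCl ℓ), B.det ≠ 0 ∧ (Matrix.transpose B = B ∨ Matrix.transpose B = -B) ∧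 (∀ g : Field.absoluteGaloisGroup K, ∃ s : PadicAlgCl ℓ, Matrix.transpose ((ρ g : GL (Fin n) (PadicAlgCl ℓ)) : Matrix (Fin n) (Fin n) (PadicAlgCl ℓ)) * B * ((ρ g : GL (Fin n) (PadicAlgCl ℓ)) : Matrix (Fin n) (Fin n) (PadicAlgCl ℓ)) = s • B) ∧ ∀ (φ : K →+* ℝ) (c : Field.absoluteGaloisGroup K), Literature.NumberTheory.GaloisRepresentations.IsComplexConjugation φ c → Matrix.transpose (B * ((ρ c : GL (Fin n) (PadicAlgCl ℓ)) : Matrix (Fin n) (Fin n) (PadicAlgCl ℓ))) = B * ((ρ c : GL (Fin n) (PadicAlgCl ℓ)) : Matrix (Fin n) (Fin n) (PadicAlgCl ℓ))) → (∀ (v : IsDedekindDomain.HeightOneSpectrum (NumberField.RingOfIntegers K)) (hv : ((ℓ : ℕ) : NumberField.RingOfIntegers K) ∈ v.asIdeal), ∀ τ : v.adicCompletion K →+* PadicAlgCl ℓ, Continuous τ → ∀ w : ℤ, Multiset.count w (ρ.labelledHodgeTateWeightsAt v (Literature.NumberTheory.PAdicHodge.fontainePstAdicCompletion v ℓ hv).algebra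 (Literature.NumberTheory.PAdicHodge.fontainePstAdicCompletion v ℓ hv).𝔅 τ) ≤ 2) → ¬ (∀ (v : IsDedekindDomain.HeightOneSpectrum (NumberField.RingOfIntegers K)) (hv : ((ℓ : ℕ) : NumberField.RingOfIntegers K) ∈ v.asIdeal), ∀ τ : v.adicCompletion K →+* PadicAlgCl ℓ, Continuous τ → (ρ.labelledHodgeTateWeightsAt v (Literature.NumberTheory.PAdicHodge.fontainePstAdicCompletion v ℓ hv).algebra (Literature.NumberTheory.PAdicHodge.fontainePstAdicCompletion v ℓ hv).𝔅 τ).Nodup) → n = 2 → ρ.IsOdd → ¬ (∀ (v : IsDedekindDomain.HeightOneSpectrum (NumberField.RingOfIntegers K)) (hv : ((ℓ : ℕ) : NumberField.RingOfIntegers K) ∈ v.asIdeal), ∀ τ : v.adicCompletion K →+* PadicAlgCl ℓ, Continuous τ → ∀ a ∈ ρ.labelledHodgeTateWeightsAt v (Literature.NumberTheory.PAdicHodge.fontainePstAdicCompletion v ℓ hv).algebra (Literature.NumberTheory.PAdicHodge.fontainePstAdicCompletion v ℓ hv).𝔅 τ, ∀ b ∈ ρ.labelledHodgeTateWeightsAt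 v (Literature.NumberTheory.PAdicHodge.fontainePstAdicCompletion v ℓ hv).algebra (Literature.NumberTheory.PAdicHodge.fontainePstAdicCompletion v ℓ hv).𝔅 τ, a = b) → ¬ (∃ (L : Type) (_ : Field L) (_ : NumberField L) (_ : Algebra K L), ∀ σ : Field.absoluteGaloisGroup L, ∃ c : PadicAlgCl ℓ, ((ρ.restrictField L σ : GL (Fin n) (PadicAlgCl ℓ)) : Matrix (Fin n) (Fin n) (PadicAlgCl ℓ)) = c • (1 : Matrix (Fin n) (Fin n) (PadicAlgCl ℓ))) → (∀ (L : Type) [Field L] [NumberField L] [Algebra K L], Module.finrank K L = 2 → (ρ.restrictField L).toGaloisRep.IsIrreducible) → ∃ π : Literature.NumberTheory.Automorphic.CuspidalAutomorphicRepData n K hcpt, π.1.IsLAlgebraic ∧ ∀ᶠ v : IsDedekindDomain.HeightOneSpectrum (NumberField.RingOfIntegers K) in Filter.cofinite, SatakeFrobCompatibleAt ι π.1 ρ v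

-- parent: HolomorphicLimitAutomorphy · child (gen 1)
/--     item stmt-Langlands-32993 · crux · rank 205 · open
    parent: HolomorphicLimitAutomorphy · by planner
    why it might fail: Even modulo rank 2: abelian surfaces over totally real K ≠ ℚ are only potentially modular (BCGP); over ℚ modularity needs big residual image at 3 (and conditions at 2); primitive GO₄-type irregular ρ that are not tensor products have no engine; Calegari: «genuinely stuck at potential».
    sources: arXiv:1812.09269, BoxerCalegariGeePilloni2025, BCGP2025ModularityAbelianSurfaces, Literature.NumberTheory.DiophantineGeometry.bcgp2025_modThreeSurjective_modular_abelianSurface, ArthurClozel1989, Pilloni2020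
[crux] R4† — RANK-FOUR HOLOMORPHIC LIMITS MODULO RANK TWO (child 5/5 of HL_TR stmt-Langlands-32003 —
lens-5 g7 v3; DECLARED RESIDUAL #2 of the split; UNDECIDED but INSTRUMENTABLE; IH form = critic F1b,
CRITIC-LEDGER row 109, precedent row 26 «LieImprimitiveTransport (IH)»; WEAKER than HL_TR and than
v2's R4, kernels `sharp_of_hl`, `r4dagger_of_r4`; Langlands-implied): (HL_TR restricted to n = 2,
over ALL totally real fields) → (HL_TR restricted to n = 4). The hypothesis HL2 is literally HL_TR
with the literal n = 2 (⟸ OA ∧ OB ∧ PW1♯ ∧ LOW♭, kernel `hl2_of_sharp`), so the IMPRIMITIVE rank-4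
limits ρ = Ind_{F₂}^K r — r odd irreducible of partial weight one over a totally real quadratic F₂/K
(critic's witness W1: K = ℚ, F₂ = ℚ(√5), labelled weights {1,1}, {0,2} ↦ {0,1,1,2}; B = J ⊕ μ(σ̃)J
alternating, odd-signed blockwise), or r dihedral — are discharged INSIDE the piece from the
hypothesis at F₂ by automorphic induction (Arthur–Clozel III.6.2; cuspidal iff r ≇ r^σ; induced
Satake parameters) and are NOT counted a second time against PW1♯; given the rank-2 pieces R4† ⟺
v2's R4 (kernel `r4_iff_dagger_of_rank2`). Honest open content = PRIMITIVE rank-4 holomorphic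
limits: B alternating ( -/
@[route_item "route-Langlands-HolomorphicLimitSplit"]
def RankFourModRankTwoAutomorphy : Prop :=
  (∀ (K : Type) [Field K] [NumberField K], NumberField.IsTotallyReal K → ∀ (n : ℕ) (hcpt : Literature.NumberTheory.Automorphic.isCompact_glFiniteIntegralLevel n K), 0 < n → ∀ (ℓ : ℕ) [Fact ℓ.Prime] (ι : PadicAlgCl ℓ ≃+* ℂ) (ρ : Literature.NumberTheory.GaloisRepresentations.FramedGaloisRep K (PadicAlgCl ℓ) n), ρ.toGaloisRep.IsIrreducible → ((∀ᶠ v : IsDedekindDomain.HeightOneSpectrum (NumberField.RingOfIntegers K) in Filter.cofinite, ρ.IsUnramifiedAt v) ∧ ∀ (v : IsDedekindDomain.HeightOneSpectrum (NumberField.RingOfIntegers K)) (hv : ((ℓ : ℕ) : NumberField.RingOfIntegers K) ∈ v.asIdeal), (Literature.NumberTheory.PAdicHodge.fontainePstAdicCompletion v ℓ hv).IsDeRhamFramed (ρ.toLocal v)) → n ≤ 4 → (∃ B : Matrix (Fin n) (Fin n) (PadicAlgCl ℓ), B.det ≠ 0 ∧ (Matrix.transpose B = B ∨ Matrix.transpose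 B = -B) ∧ (∀ g : Field.absoluteGaloisGroup K, ∃ s : PadicAlgCl ℓ, Matrix.transpose ((ρ g : GL (Fin n) (PadicAlgCl ℓ)) : Matrix (Fin n) (Fin n) (PadicAlgCl ℓ)) * B * ((ρ g : GL (Fin n) (PadicAlgCl ℓ)) : Matrix (Fin n) (Fin n) (PadicAlgCl ℓ)) = s • B) ∧ ∀ (φ : K →+* ℝ) (c : Field.absoluteGaloisGroup K), Literature.NumberTheory.GaloisRepresentations.IsComplexConjugation φ c → Matrix.transpose (B * ((ρ c : GL (Fin n) (PadicAlgCl ℓ)) : Matrix (Fin n) (Fin n) (PadicAlgCl ℓ))) = B * ((ρ c : GL (Fin n) (PadicAlgCl ℓ)) : Matrix (Fin n) (Fin n) (PadicAlgCl ℓ))) → (∀ (v : IsDedekindDomain.HeightOneSpectrum (NumberField.RingOfIntegers K)) (hv : ((ℓ : ℕ) : NumberField.RingOfIntegers K) ∈ v.asIdeal), ∀ τ : v.adicCompletion K →+* PadicAlgCl ℓ, Continuous τ → ∀ w : ℤ, Multiset.count w (ρ.labelledHodgeTateWeightsAt v (Literature.NumberTheory.PAdicHodge.fontainePstAdicCompletion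 v ℓ hv).algebra (Literature.NumberTheory.PAdicHodge.fontainePstAdicCompletion v ℓ hv).𝔅 τ) ≤ 2) → ¬ (∀ (v : IsDedekindDomain.HeightOneSpectrum (NumberField.RingOfIntegers K)) (hv : ((ℓ : ℕ) : NumberField.RingOfIntegers K) ∈ v.asIdeal), ∀ τ : v.adicCompletion K →+* PadicAlgCl ℓ, Continuous τ → (ρ.labelledHodgeTateWeightsAt v (Literature.NumberTheory.PAdicHodge.fontainePstAdicCompletion v ℓ hv).algebra (Literature.NumberTheory.PAdicHodge.fontainePstAdicCompletion v ℓ hv).𝔅 τ).Nodup) → n = 2 → ∃ π : Literature.NumberTheory.Automorphic.CuspidalAutomorphicRepData n K hcpt, π.1.IsLAlgebraic ∧ ∀ᶠ v : IsDedekindDomain.HeightOneSpectrum (NumberField.RingOfIntegers K) in Filter.cofinite, SatakeFrobCompatibleAt ι π.1 ρ v) → ∀ (K : Type) [Field K] [NumberField K], NumberField.IsTotallyReal K → ∀ (n : ℕ) (hcpt : Literature.NumberTheory.Automorphic.isCompact_glFiniteIntegralLevel n K), 0 < n → ∀ (ℓ : ℕ) [Fact ℓ.Prime] (ι : PadicAlgCl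 ℓ ≃+* ℂ) (ρ : Literature.NumberTheory.GaloisRepresentations.FramedGaloisRep K (PadicAlgCl ℓ) n), ρ.toGaloisRep.IsIrreducible → ((∀ᶠ v : IsDedekindDomain.HeightOneSpectrum (NumberField.RingOfIntegers K) in Filter.cofinite, ρ.IsUnramifiedAt v) ∧ ∀ (v : IsDedekindDomain.HeightOneSpectrum (NumberField.RingOfIntegers K)) (hv : ((ℓ : ℕ) : NumberField.RingOfIntegers K) ∈ v.asIdeal), (Literature.NumberTheory.PAdicHodge.fontainePstAdicCompletion v ℓ hv).IsDeRhamFramed (ρ.toLocal v)) → n ≤ 4 → (∃ B : Matrix (Fin n) (Fin n) (PadicAlgCl ℓ), B.det ≠ 0 ∧ (Matrix.transpose B = B ∨ Matrix.transpose B = -B) ∧ (∀ g : Field.absoluteGaloisGroup K, ∃ s : PadicAlgCl ℓ, Matrix.transpose ((ρ g : GL (Fin n) (PadicAlgCl ℓ)) : Matrix (Fin n) (Fin n) (PadicAlgCl ℓ)) * B * ((ρ g : GL (Fin n) (PadicAlgCl ℓ)) : Matrix (Fin n) (Fin n) (PadicAlgCl ℓ)) = s • B) ∧ ∀ (φ :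 K →+* ℝ) (c : Field.absoluteGaloisGroup K), Literature.NumberTheory.GaloisRepresentations.IsComplexConjugation φ c → Matrix.transpose (B * ((ρ c : GL (Fin n) (PadicAlgCl ℓ)) : Matrix (Fin n) (Fin n) (PadicAlgCl ℓ))) = B * ((ρ c : GL (Fin n) (PadicAlgCl ℓ)) : Matrix (Fin n) (Fin n) (PadicAlgCl ℓ))) → (∀ (v : IsDedekindDomain.HeightOneSpectrum (NumberField.RingOfIntegers K)) (hv : ((ℓ : ℕ) : NumberField.RingOfIntegers K) ∈ v.asIdeal), ∀ τ : v.adicCompletion K →+* PadicAlgCl ℓ, Continuous τ → ∀ w : ℤ, Multiset.count w (ρ.labelledHodgeTateWeightsAt v (Literature.NumberTheory.PAdicHodge.fontainePstAdicCompletion v ℓ hv).algebra (Literature.NumberTheory.PAdicHodge.fontainePstAdicCompletion v ℓ hv).𝔅 τ) ≤ 2) → ¬ (∀ (v : IsDedekindDomain.HeightOneSpectrum (NumberField.RingOfIntegers K)) (hv : ((ℓ : ℕ) : NumberField.RingOfIntegers K) ∈ v.asIdeal), ∀ τ : v.adicCompletion K →+* PadicAlgCl ℓ, Continuous τ → (ρ.labelledHodgeTateWeightsAt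 v (Literature.NumberTheory.PAdicHodge.fontainePstAdicCompletion v ℓ hv).algebra (Literature.NumberTheory.PAdicHodge.fontainePstAdicCompletion v ℓ hv).𝔅 τ).Nodup) → n = 4 → ∃ π : Literature.NumberTheory.Automorphic.CuspidalAutomorphicRepData n K hcpt, π.1.IsLAlgebraic ∧ ∀ᶠ v : IsDedekindDomain.HeightOneSpectrum (NumberField.RingOfIntegers K) in Filter.cofinite, SatakeFrobCompatibleAt ι π.1 ρ v

-- parent: HolomorphicLimitAutomorphy · child (gen 1)
/--     item stmt-Langlands-32989 · support · rank 201 · open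
    parent: HolomorphicLimitAutomorphy · by planner
    why it might fail: Only the transport can fail as typed: lifting the finite projective image to an Artin σ₀ with ρ ≅ ι⁻¹σ₀ ⊗ η (Tate), η geometric ⟹ Hecke, and π(σ₀) ⊗ η L-algebraic with the tree's Satake normalisation at every good place; Pilloni–Stroh needs p-adic glueing facts not yet typed.
    sources: PilloniStroh2016Asterisque, Literature.NumberTheory.Automorphic.pilloniStroh_strongArtin_of_isIcosahedralType, Literature.NumberTheory.Automorphic.strongArtin_of_isDihedralType, KhareWintenberger2009, Literature.NumberTheory.Automorphic.khareWintenberger_weightOne_of_isOdd, Kassaei2011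
[support] OA — ODD ARTIN-TYPE RANGE (child 1/5 of HL_TR `HolomorphicLimitAutomorphy`
stmt-Langlands-32003 — decomp-langlands lens-5 g7 node WeightOneBridgeSplit, «finite/base range»;
THEOREM-GRADE IN PRINT modulo the ℓ-adic ↔ Artin transport; WEAKER than HL_TR: HL_TR's hypotheses
VERBATIM plus three dial literals, kernel `pieces_of_hl`; Langlands-implied, kernel
`Cert.pieces_of_langlands`): for every totally real K, hcpt, (ℓ, ι) and every irreducible
pinned-geometric ρ : Γ_K → GL_n(ℚ̄_ℓ) in HL_TR's box (totally odd-signed polarization, labelled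
Hodge–Tate multiplicities ≤ 2, not HT-regular) with n = 2, ρ TOTALLY ODD (tree predicate
`FramedGaloisRep.IsOdd`: det ρ(c) = −1 at every complex conjugation of every real place) and of
FINITE PROJECTIVE IMAGE (ρ|Γ_L scalar for some number field L ⊇ K — verbatim the dial of
ParityLadder.EvenArtinAutomorphy 29751), ρ is weakly automorphic (an L-algebraic cuspidal π on GL₂/K
with Satake = Frobenius at almost all v). In print: ρ ≅ ι⁻¹σ₀ ⊗ η with σ₀ an odd irreducible Artin
representation (Tate lifting of the finite projective image) and η a geometric character; σ₀ is
automorphic of parallel weight one by Pilloni–Stroh, Astérisque 382 (2016) Thm -/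
@[route_item "route-Langlands-HolomorphicLimitSplit"]
def OddArtinTypeAutomorphy : Prop :=
  ∀ (K : Type) [Field K] [NumberField K], NumberField.IsTotallyReal K → ∀ (n : ℕ) (hcpt : Literature.NumberTheory.Automorphic.isCompact_glFiniteIntegralLevel n K), 0 < n → ∀ (ℓ : ℕ) [Fact ℓ.Prime] (ι : PadicAlgCl ℓ ≃+* ℂ) (ρ : Literature.NumberTheory.GaloisRepresentations.FramedGaloisRep K (PadicAlgCl ℓ) n), ρ.toGaloisRep.IsIrreducible → ((∀ᶠ v : IsDedekindDomain.HeightOneSpectrum (NumberField.RingOfIntegers K) in Filter.cofinite, ρ.IsUnramifiedAt v) ∧ ∀ (v : IsDedekindDomain.HeightOneSpectrum (NumberField.RingOfIntegers K)) (hv : ((ℓ : ℕ) : NumberField.RingOfIntegers K) ∈ v.asIdeal), (Literature.NumberTheory.PAdicHodge.fontainePstAdicCompletion v ℓ hv).IsDeRhamFramed (ρ.toLocal v)) → n ≤ 4 → (∃ B : Matrix (Fin n) (Fin n) (PadicAlgCl ℓ), B.det ≠ 0 ∧ (Matrix.transpose B = B ∨ Matrix.transpose B = -B) ∧ (∀ g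 : Field.absoluteGaloisGroup K, ∃ s : PadicAlgCl ℓ, Matrix.transpose ((ρ g : GL (Fin n) (PadicAlgCl ℓ)) : Matrix (Fin n) (Fin n) (PadicAlgCl ℓ)) * B * ((ρ g : GL (Fin n) (PadicAlgCl ℓ)) : Matrix (Fin n) (Fin n) (PadicAlgCl ℓ)) = s • B) ∧ ∀ (φ : K →+* ℝ) (c : Field.absoluteGaloisGroup K), Literature.NumberTheory.GaloisRepresentations.IsComplexConjugation φ c → Matrix.transpose (B * ((ρ c : GL (Fin n) (PadicAlgCl ℓ)) : Matrix (Fin n) (Fin n) (PadicAlgCl ℓ))) = B * ((ρ c : GL (Fin n) (PadicAlgCl ℓ)) : Matrix (Fin n) (Fin n) (PadicAlgCl ℓ))) → (∀ (v : IsDedekindDomain.HeightOneSpectrum (NumberField.RingOfIntegers K)) (hv : ((ℓ : ℕ) : NumberField.RingOfIntegers K) ∈ v.asIdeal), ∀ τ : v.adicCompletion K →+* PadicAlgCl ℓ, Continuous τ → ∀ w : ℤ, Multiset.count w (ρ.labelledHodgeTateWeightsAt v (Literature.NumberTheory.PAdicHodge.fontainePstAdicCompletion v ℓ hv).algebra (Literature.NumberTheory.PAdicHodge.fontainePstAdicCompletion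 v ℓ hv).𝔅 τ) ≤ 2) → ¬ (∀ (v : IsDedekindDomain.HeightOneSpectrum (NumberField.RingOfIntegers K)) (hv : ((ℓ : ℕ) : NumberField.RingOfIntegers K) ∈ v.asIdeal), ∀ τ : v.adicCompletion K →+* PadicAlgCl ℓ, Continuous τ → (ρ.labelledHodgeTateWeightsAt v (Literature.NumberTheory.PAdicHodge.fontainePstAdicCompletion v ℓ hv).algebra (Literature.NumberTheory.PAdicHodge.fontainePstAdicCompletion v ℓ hv).𝔅 τ).Nodup) → n = 2 → ρ.IsOdd → (∃ (L : Type) (_ : Field L) (_ : NumberField L) (_ : Algebra K L), ∀ σ : Field.absoluteGaloisGroup L, ∃ c : PadicAlgCl ℓ, ((ρ.restrictField L σ : GL (Fin n) (PadicAlgCl ℓ)) : Matrix (Fin n) (Fin n) (PadicAlgCl ℓ)) = c • (1 : Matrix (Fin n) (Fin n) (PadicAlgCl ℓ))) → ∃ π : Literature.NumberTheory.Automorphic.CuspidalAutomorphicRepData n K hcpt, π.1.IsLAlgebraic ∧ ∀ᶠ v : IsDedekindDomain.HeightOneSpectrum (NumberField.RingOfIntegers K) in Filter.cofinite, SatakeFrobCompatibleAt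 ι π.1 ρ v

-- parent: HolomorphicLimitAutomorphy · child (gen 1)
/--     item stmt-Langlands-32992 · support · rank 204 · open
    parent: HolomorphicLimitAutomorphy · by planner
    why it might fail: Typing debt only: index-2 Clifford theory (ρ|Γ_L reducible ⟹ ρ ≅ Ind ψ), Fontaine–Mazur for characters (geometric ⟹ Hecke) and automorphic induction GL₁/L → GL₂/K with the tree's Satake normalisation; n = 1 / n = 3 emptiness needs card(labelled HT weights) = n; none yet in the tree.
    sources: JacquetLanglands1970, LabesseLanglands1979, Literature.NumberTheory.Automorphic.strongArtin_of_isDihedralType, ArthurClozel1989, Jarvis1997, arXiv:2109.14145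
[support] LOW♭ — LOW-RANK AND DIHEDRAL DEBRIS (child 4/5 of HL_TR stmt-Langlands-32003 — lens-5 g7
v3; PRINT/VACUOUS-GRADE; WEAKER than HL_TR, kernel `sharp_of_hl`; Langlands-implied): HL_TR's box
with n ≠ 4 and NOT (n = 2 ∧ ρ totally odd ∧ (finite projective image ∨ HT-scalar ∨ quadratically
primitive)) ⟹ ρ weakly automorphic; = v2's LOW ∧ the dihedral island DPW (kernel `lowDih_iff`). With
HL_TR's 0 < n ≤ 4: n = 1 — a character is HT-regular, box EMPTY; n = 3 — B symmetric, GO₃ ≅ PGL₂ ×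
GL₁, ρ ≅ Ad⁰(r) ⊗ χ (Tate) with labelled weights {a + c, c, c − a}, never «multiplicity ≤ 2 ∧
irregular»: EMPTY; n = 2 not totally odd — an alternating B forces det ρ(c) = −1, so B is symmetric,
ρ(Γ_K) ⊂ GO₂, ρ ≅ Ind_L^K ψ: automorphic induction from GL₁ (PRINT); and — v3, critic b1 — n = 2
totally odd, infinite projective image, non-scalar weights, ρ|Γ_L REDUCIBLE for some quadratic L/K:
Clifford ⟹ ρ ≅ Ind_L^K ψ (L CM — over a quadratic L with a real place a geometric ψ is finite ·
cyclotomic power and ρ would have finite projective image), ψ geometric ⟹ algebraic Hecke character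
(rank-1 Fontaine–Mazur = class field theory + Weil) ⟹ automorphic induction GL₁/L → GL₂/K
(Jacquet–Langlands §12, Labe -/
@[route_item "route-Langlands-HolomorphicLimitSplit"]
def LowRankDihedralLimitAutomorphy : Prop :=
  ∀ (K : Type) [Field K] [NumberField K], NumberField.IsTotallyReal K → ∀ (n : ℕ) (hcpt : Literature.NumberTheory.Automorphic.isCompact_glFiniteIntegralLevel n K), 0 < n → ∀ (ℓ : ℕ) [Fact ℓ.Prime] (ι : PadicAlgCl ℓ ≃+* ℂ) (ρ : Literature.NumberTheory.GaloisRepresentations.FramedGaloisRep K (PadicAlgCl ℓ) n), ρ.toGaloisRep.IsIrreducible → ((∀ᶠ v : IsDedekindDomain.HeightOneSpectrum (NumberField.RingOfIntegers K) in Filter.cofinite, ρ.IsUnramifiedAt v) ∧ ∀ (v : IsDedekindDomain.HeightOneSpectrum (NumberField.RingOfIntegers K)) (hv : ((ℓ : ℕ) : NumberField.RingOfIntegers K) ∈ v.asIdeal), (Literature.NumberTheory.PAdicHodge.fontainePstAdicCompletion v ℓ hv).IsDeRhamFramed (ρ.toLocal v)) → n ≤ 4 → (∃ B : Matrix (Fin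 n) (Fin n) (PadicAlgCl ℓ), B.det ≠ 0 ∧ (Matrix.transpose B = B ∨ Matrix.transpose B = -B) ∧ (∀ g : Field.absoluteGaloisGroup K, ∃ s : PadicAlgCl ℓ, Matrix.transpose ((ρ g : GL (Fin n) (PadicAlgCl ℓ)) : Matrix (Fin n) (Fin n) (PadicAlgCl ℓ)) * B * ((ρ g : GL (Fin n) (PadicAlgCl ℓ)) : Matrix (Fin n) (Fin n) (PadicAlgCl ℓ)) = s • B) ∧ ∀ (φ : K →+* ℝ) (c : Field.absoluteGaloisGroup K), Literature.NumberTheory.GaloisRepresentations.IsComplexConjugation φ c → Matrix.transpose (B * ((ρ c : GL (Fin n) (PadicAlgCl ℓ)) : Matrix (Fin n) (Fin n) (PadicAlgCl ℓ))) = B * ((ρ c : GL (Fin n) (PadicAlgCl ℓ)) : Matrix (Fin n) (Fin n) (PadicAlgCl ℓ))) → (∀ (v : IsDedekindDomain.HeightOneSpectrum (NumberField.RingOfIntegers K)) (hv : ((ℓ : ℕ) : NumberField.RingOfIntegers K) ∈ v.asIdeal), ∀ τ : v.adicCompletion K →+* PadicAlgCl ℓ, Continuous τ → ∀ w : ℤ,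 Multiset.count w (ρ.labelledHodgeTateWeightsAt v (Literature.NumberTheory.PAdicHodge.fontainePstAdicCompletion v ℓ hv).algebra (Literature.NumberTheory.PAdicHodge.fontainePstAdicCompletion v ℓ hv).𝔅 τ) ≤ 2) → ¬ (∀ (v : IsDedekindDomain.HeightOneSpectrum (NumberField.RingOfIntegers K)) (hv : ((ℓ : ℕ) : NumberField.RingOfIntegers K) ∈ v.asIdeal), ∀ τ : v.adicCompletion K →+* PadicAlgCl ℓ, Continuous τ → (ρ.labelledHodgeTateWeightsAt v (Literature.NumberTheory.PAdicHodge.fontainePstAdicCompletion v ℓ hv).algebra (Literature.NumberTheory.PAdicHodge.fontainePstAdicCompletion v ℓ hv).𝔅 τ).Nodup) → n ≠ 4 → ¬ (n = 2 ∧ ρ.IsOdd ∧ ((∃ (L : Type) (_ : Field L) (_ : NumberField L) (_ : Algebra K L), ∀ σ : Field.absoluteGaloisGroup L, ∃ c : PadicAlgCl ℓ, ((ρ.restrictField L σ : GL (Fin n) (PadicAlgCl ℓ)) : Matrix (Fin n) (Fin n) (PadicAlgCl ℓ)) = c • (1 : Matrix (Fin n) (Fin n) (PadicAlgCl ℓ)))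 ∨ (∀ (v : IsDedekindDomain.HeightOneSpectrum (NumberField.RingOfIntegers K)) (hv : ((ℓ : ℕ) : NumberField.RingOfIntegers K) ∈ v.asIdeal), ∀ τ : v.adicCompletion K →+* PadicAlgCl ℓ, Continuous τ → ∀ a ∈ ρ.labelledHodgeTateWeightsAt v (Literature.NumberTheory.PAdicHodge.fontainePstAdicCompletion v ℓ hv).algebra (Literature.NumberTheory.PAdicHodge.fontainePstAdicCompletion v ℓ hv).𝔅 τ, ∀ b ∈ ρ.labelledHodgeTateWeightsAt v (Literature.NumberTheory.PAdicHodge.fontainePstAdicCompletion v ℓ hv).algebra (Literature.NumberTheory.PAdicHodge.fontainePstAdicCompletion v ℓ hv).𝔅 τ, a = b) ∨ (∀ (L : Type) [Field L] [NumberField L] [Algebra K L], Module.finrank K L = 2 → (ρ.restrictField L).toGaloisRep.IsIrreducible))) → ∃ π : Literature.NumberTheory.Automorphic.CuspidalAutomorphicRepData n K hcpt, π.1.IsLAlgebraic ∧ ∀ᶠ v : IsDedekindDomain.HeightOneSpectrum (NumberField.RingOfIntegers K) in Filter.cofinite, SatakeFrobCompatibleAt ι π.1 ρ v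

-- parent: HolomorphicLimitAutomorphy · glue (gen 1)
/--     item stmt-Langlands-32994 · support · rank 206 · closed · proved by Summit.Langlands.Langlands.Theorems.HolomorphicLimitAutomorphy_of_wsplit_proof (prover)
    parent: HolomorphicLimitAutomorphy · GLUE: children ⟹ parent · by planner
OddArtinTypeAutomorphy → OddWeightOneBridgeAutomorphy → PrimitivePartialWeightOneAutomorphy →
LowRankDihedralLimitAutomorphy → RankFourModRankTwoAutomorphy → HolomorphicLimitAutomorphy — pure
logic: excluded middles on the inlined dials (n = 4; n = 2 ∧ ρ totally odd ∧ (finite projective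
image ∨ HT-scalar ∨ quadratically primitive)) plus one modus ponens feeding the rank-2 part to the
IH-form child; every child is HolomorphicLimitAutomorphy with its hypotheses verbatim plus dial
literals (R4† = rank-2 box → rank-4 box); decomp-langlands lens-5 g7 v3 node kernel hl_of_sharp,
certified as HolomorphicLimitAutomorphy_of_wsplit_proof
(nodes/lens-5-g7-WeightOneBridgeSplit.kit_check_split.lean rc 0 against the born host module, axioms
standard) -/
@[route_item "route-Langlands-HolomorphicLimitSplit"]
def HolomorphicLimitAutomorphy_of_wsplit : Prop :=
  OddArtinTypeAutomorphy → OddWeightOneBridgeAutomorphy → PrimitivePartialWeightOneAutomorphy → LowRankDihedralLimitAutomorphy → RankFourModRankTwoAutomorphy → HolomorphicLimitAutomorphy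

-- `HolomorphicLimitAutomorphy_of_wsplit` holds: proved by `Summit.Langlands.Langlands.Theorems.HolomorphicLimitAutomorphy_of_wsplit_proof` (its module imports this route file, so no `_holds` link can be stated here).

/-- item stmt-Langlands-32004 · crux · rank 3 · SPLIT (gen 1) into TwistedArtinFinitePoles, UnramifiedPoleBootstrap, NonArtinDarkAutomorphy, ArtinConverseDictionary, ArtinMoveTransport + glue NonLimitIrregularAutomorphy_of_artinsplit · direct attempts still welcome (low priority) · by planner
why it might fail: It IS the dark core: even icosahedral Artin (nothing since Langlands–Tunnell), rank ≥ 3 Artin, abelian g ≥ 3-folds, CY/K3-type irregular motives over totally real fields — no Shimura realization, no limit of discrete series, no p-adic glueing; the typed summit may fail here first.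
sources: Calegari2011EvenFM, arXiv:0804.2860, doi:10.2140/ant.2012.6.405, BuzzardGee2014, Literature.Barriers.Langlands.NonRegularWeightBarrier, Literature.Barriers.Langlands.ShimuraVarietyRealization
[crux] NL_TR — NON-REGULARIZABLE AND NO HOLOMORPHIC-LIMIT MOVE (child 2/3 of IRR*_TR 31691; DECLARED
RESIDUAL of the split = the dark core of weak reciprocity over totally real fields; WEAKER than
IRR*_TR outright — one more hypothesis —, kernel `nonLimit_of_nonRegularizable`; Langlands-implied):
for every TOTALLY REAL K, n ≥ 1, hcpt, (ℓ, ι) and every irreducible geometric ρ over K admitting NO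
regularizing move (¬MOVE(ρ/K), verbatim the parent's saturated dial) AND NO HOLOMORPHIC-LIMIT MOVE —
¬LIMMOVE(ρ/K): there are no conjugation-solvable M ⊇ K (w.r.t. K and w.r.t. a totally real F₁),
irreducible constituent θ of ρ|M (rank ≥ 1, at trace level), character χ of Γ_M and irreducible
geometric R′ over F₁ of RANK ≤ 4 with a TOTALLY ODD-SIGNED POLARIZATION and ALL LABELLED HT
MULTIPLICITIES ≤ 2 such that θ ⊗ χ is a constituent of R′|M (LIMMOVE = the parent's MOVE template
with «R′ HT-regular» replaced by «R′ of holomorphic-limit type»; saturated by construction, so the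
cell is a union of orbits of the route's own transports) —, ρ is weakly automorphic. CONTENT (why it
is dark): EVEN representations — even icosahedral Artin ρ_e (census AT1: its only polarization is
alt with μ = det, μ(c -/
@[route_item "route-Langlands-HolomorphicLimitSplit", crux]
def NonLimitIrregularAutomorphy : Prop :=
  ∀ (K : Type) [Field K] [NumberField K], NumberField.IsTotallyReal K → ∀ (n : ℕ) (hcpt : Literature.NumberTheory.Automorphic.isCompact_glFiniteIntegralLevel n K), 0 < n → ∀ (ℓ : ℕ) [Fact ℓ.Prime] (ι : PadicAlgCl ℓ ≃+* ℂ) (ρ : Literature.NumberTheory.GaloisRepresentations.FramedGaloisRep K (PadicAlgCl ℓ) n), ρ.toGaloisRep.IsIrreducible → ((∀ᶠ v : IsDedekindDomain.HeightOneSpectrum (NumberField.RingOfIntegers K) in Filter.cofinite, ρ.IsUnramifiedAt v) ∧ ∀ (v : IsDedekindDomain.HeightOneSpectrum (NumberField.RingOfIntegers K)) (hv : ((ℓ : ℕ) : NumberField.RingOfIntegers K) ∈ v.asIdeal), (Literature.NumberTheory.PAdicHodge.fontainePstAdicCompletion v ℓ hv).IsDeRhamFramed (ρ.toLocal v)) →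 ¬ (∃ (M E₀ : Type) (_ : Field M) (_ : NumberField M) (_ : Field E₀) (_ : NumberField E₀) (_ : Algebra K M) (_ : Algebra M E₀) (_ : Algebra K E₀) (_ : IsScalarTower K M E₀) (_ : IsGalois K E₀), IsSolvable (E₀ ≃ₐ[K] E₀) ∧ ∃ (F₁ E₁ : Type) (_ : Field F₁) (_ : NumberField F₁) (_ : Field E₁) (_ : NumberField E₁) (_ : Algebra F₁ M) (_ : Algebra M E₁) (_ : Algebra F₁ E₁) (_ : IsScalarTower F₁ M E₁) (_ : IsGalois F₁ E₁), NumberField.IsTotallyReal F₁ ∧ IsSolvable (E₁ ≃ₐ[F₁] E₁) ∧ ∃ (m : ℕ) (θ : Literature.NumberTheory.GaloisRepresentations.FramedGaloisRep M (PadicAlgCl ℓ) m), 0 < m ∧ θ.toGaloisRep.IsIrreducible ∧ (∃ (mc : ℕ) (θc : Literature.NumberTheory.GaloisRepresentations.FramedGaloisRep M (PadicAlgCl ℓ) mc), ∀ g : Field.absoluteGaloisGroup M, Literature.NumberTheory.GaloisRepresentations.FramedRep.trace (ρ.restrictField M) g = Literature.NumberTheory.GaloisRepresentations.FramedRep.trace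 θ g + Literature.NumberTheory.GaloisRepresentations.FramedRep.trace θc g) ∧ ∃ (χ : Literature.NumberTheory.GaloisRepresentations.FramedGaloisRep M (PadicAlgCl ℓ) 1) (n' : ℕ) (R' : Literature.NumberTheory.GaloisRepresentations.FramedGaloisRep F₁ (PadicAlgCl ℓ) n'), 0 < n' ∧ R'.toGaloisRep.IsIrreducible ∧ ((∀ᶠ v : IsDedekindDomain.HeightOneSpectrum (NumberField.RingOfIntegers F₁) in Filter.cofinite, R'.IsUnramifiedAt v) ∧ ∀ (v : IsDedekindDomain.HeightOneSpectrum (NumberField.RingOfIntegers F₁)) (hv : ((ℓ : ℕ) : NumberField.RingOfIntegers F₁) ∈ v.asIdeal), (Literature.NumberTheory.PAdicHodge.fontainePstAdicCompletion v ℓ hv).IsDeRhamFramed (R'.toLocal v)) ∧ (∀ (v : IsDedekindDomain.HeightOneSpectrum (NumberField.RingOfIntegers F₁)) (hv : ((ℓ : ℕ) : NumberField.RingOfIntegers F₁) ∈ v.asIdeal), ∀ τ : v.adicCompletion F₁ →+* PadicAlgCl ℓ, Continuous τ → (R'.labelledHodgeTateWeightsAt v (Literature.NumberTheory.PAdicHodge.fontainePstAdicCompletion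 v ℓ hv).algebra (Literature.NumberTheory.PAdicHodge.fontainePstAdicCompletion v ℓ hv).𝔅 τ).Nodup) ∧ (∃ (mc' : ℕ) (θc' : Literature.NumberTheory.GaloisRepresentations.FramedGaloisRep M (PadicAlgCl ℓ) mc'), ∀ g : Field.absoluteGaloisGroup M, Literature.NumberTheory.GaloisRepresentations.FramedRep.trace (R'.restrictField M) g = Literature.NumberTheory.GaloisRepresentations.FramedRep.trace χ g * Literature.NumberTheory.GaloisRepresentations.FramedRep.trace θ g + Literature.NumberTheory.GaloisRepresentations.FramedRep.trace θc' g)) → ¬ (∃ (M E₀ : Type) (_ : Field M) (_ : NumberField M) (_ : Field E₀) (_ : NumberField E₀) (_ : Algebra K M) (_ : Algebra M E₀) (_ : Algebra K E₀) (_ : IsScalarTower K M E₀) (_ : IsGalois K E₀), IsSolvable (E₀ ≃ₐ[K] E₀) ∧ ∃ (F₁ E₁ : Type) (_ : Field F₁) (_ : NumberField F₁) (_ : Field E₁) (_ : NumberField E₁) (_ : Algebra F₁ M) (_ : Algebra M E₁) (_ : Algebra F₁ E₁) (_ : IsScalarTower F₁ M E₁) (_ : IsGalois F₁ E₁), NumberField.IsTotallyReal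 F₁ ∧ IsSolvable (E₁ ≃ₐ[F₁] E₁) ∧ ∃ (m : ℕ) (θ : Literature.NumberTheory.GaloisRepresentations.FramedGaloisRep M (PadicAlgCl ℓ) m), 0 < m ∧ θ.toGaloisRep.IsIrreducible ∧ (∃ (mc : ℕ) (θc : Literature.NumberTheory.GaloisRepresentations.FramedGaloisRep M (PadicAlgCl ℓ) mc), ∀ g : Field.absoluteGaloisGroup M, Literature.NumberTheory.GaloisRepresentations.FramedRep.trace (ρ.restrictField M) g = Literature.NumberTheory.GaloisRepresentations.FramedRep.trace θ g + Literature.NumberTheory.GaloisRepresentations.FramedRep.trace θc g) ∧ ∃ (χ : Literature.NumberTheory.GaloisRepresentations.FramedGaloisRep M (PadicAlgCl ℓ) 1) (n' : ℕ) (R' : Literature.NumberTheory.GaloisRepresentations.FramedGaloisRep F₁ (PadicAlgCl ℓ) n'), 0 < n' ∧ R'.toGaloisRep.IsIrreducible ∧ ((∀ᶠ v : IsDedekindDomain.HeightOneSpectrum (NumberField.RingOfIntegers F₁) in Filter.cofinite, R'.IsUnramifiedAt v) ∧ ∀ (v : IsDedekindDomain.HeightOneSpectrum (NumberField.RingOfIntegers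 F₁)) (hv : ((ℓ : ℕ) : NumberField.RingOfIntegers F₁) ∈ v.asIdeal), (Literature.NumberTheory.PAdicHodge.fontainePstAdicCompletion v ℓ hv).IsDeRhamFramed (R'.toLocal v)) ∧ n' ≤ 4 ∧ (∃ B : Matrix (Fin n') (Fin n') (PadicAlgCl ℓ), B.det ≠ 0 ∧ (Matrix.transpose B = B ∨ Matrix.transpose B = -B) ∧ (∀ g : Field.absoluteGaloisGroup F₁, ∃ s : PadicAlgCl ℓ, Matrix.transpose ((R' g : GL (Fin n') (PadicAlgCl ℓ)) : Matrix (Fin n') (Fin n') (PadicAlgCl ℓ)) * B * ((R' g : GL (Fin n') (PadicAlgCl ℓ)) : Matrix (Fin n') (Fin n') (PadicAlgCl ℓ)) = s • B) ∧ ∀ (φ : F₁ →+* ℝ) (c : Field.absoluteGaloisGroup F₁), Literature.NumberTheory.GaloisRepresentations.IsComplexConjugation φ c → Matrix.transpose (B * ((R' c : GL (Fin n') (PadicAlgCl ℓ)) : Matrix (Fin n') (Fin n') (PadicAlgCl ℓ))) = B * ((R' c : GL (Fin n') (PadicAlgCl ℓ)) : Matrix (Fin n') (Fin n') (PadicAlgCl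 ℓ))) ∧ (∀ (v : IsDedekindDomain.HeightOneSpectrum (NumberField.RingOfIntegers F₁)) (hv : ((ℓ : ℕ) : NumberField.RingOfIntegers F₁) ∈ v.asIdeal), ∀ τ : v.adicCompletion F₁ →+* PadicAlgCl ℓ, Continuous τ → ∀ w : ℤ, Multiset.count w (R'.labelledHodgeTateWeightsAt v (Literature.NumberTheory.PAdicHodge.fontainePstAdicCompletion v ℓ hv).algebra (Literature.NumberTheory.PAdicHodge.fontainePstAdicCompletion v ℓ hv).𝔅 τ) ≤ 2) ∧ (∃ (mc' : ℕ) (θc' : Literature.NumberTheory.GaloisRepresentations.FramedGaloisRep M (PadicAlgCl ℓ) mc'), ∀ g : Field.absoluteGaloisGroup M, Literature.NumberTheory.GaloisRepresentations.FramedRep.trace (R'.restrictField M) g = Literature.NumberTheory.GaloisRepresentations.FramedRep.trace χ g * Literature.NumberTheory.GaloisRepresentations.FramedRep.trace θ g + Literature.NumberTheory.GaloisRepresentations.FramedRep.trace θc' g)) → ∃ π : Literature.NumberTheory.Automorphic.CuspidalAutomorphicRepData n K hcpt, π.1.IsLAlgebraic ∧ ∀ᶠ v : IsDedekindDomain.HeightOneSpectrum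 (NumberField.RingOfIntegers K) in Filter.cofinite, SatakeFrobCompatibleAt ι π.1 ρ v

-- parent: NonLimitIrregularAutomorphy · child (gen 1)
/--     item stmt-Langlands-32455 · crux · rank 301 · open
    parent: NonLimitIrregularAutomorphy · by planner
    why it might fail: Dark: no method bounds the number of poles of a non-automorphic degree-2 Euler product over a TR field (Brauer gives meromorphy only; potential automorphy never touches even Artin ρ); Langlands-implied mod print AE, so false only if reciprocity is.
    sources: doi:10.4007/annals.2003.158.1089, arXiv:math/0507502, doi:10.1112/S0010437X10005087, Brauer1947, Literature.NumberTheory.Automorphic.bookerKrishnamurthy_isPiOfArtinRep_of_entire_twists, Literature.Barriers.Langlands.NonRegularWeightBarrier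
[crux] FP · IDEA-NEEDED (dark) + INSTRUMENTABLE shadow · crux (r301 of the Shape-A split) · FP ·
piece 1 beneath the EQUIV · WEAKER than TAH (P = 1; kernel `finitePoles_of_twisted`) and STRICTLY so
modulo print: FP ⟹ TAH is Booker's pole propagation, a theorem ONLY over K = ℚ (Booker, Ann. of
Math. 158 (2003) Thm p.1090, held text paper:doi-10-4007-annals-2003-158-1089; Ω_ℚ^nr = {‖·‖^{it}})
and OPEN over K ≠ ℚ (= BOOT).  Statement: for every ρ in the box over a totally real K and every ω ∈
Ω_K^nr, the partial L-function of ρ ⊗ ω outside any finite S equals g(s)/P(s) on a right half-plane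
with g entire of finite order and P a NON-ZERO POLYNOMIAL — at most finitely many poles.
Deliberately NOT «L(ρ) entire for the box»: the box is twist-closed, so plain Artin holomorphy for
all members would contain every Dirichlet-type twist and collapse to EA by the classical
Jacquet–Langlands converse theorem (COSTUME); finitely-many-poles contains no entire L-function and
does not collapse.  IDEA-NEEDED (dark: Brauer gives meromorphy only, potential automorphy does not
touch even Artin ρ, no method bounds the number of poles of a non-automorphic Euler product) ·
INSTRUMENTABLE shadow: Booker, ar -/
@[route_item "route-Langlands-HolomorphicLimitSplit"]
def TwistedArtinFinitePoles : Prop :=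
  ∀ (K : Type) [Field K] [NumberField K], NumberField.IsTotallyReal K → ∀ (n : ℕ) (ℓ : ℕ) [Fact ℓ.Prime] (ι : PadicAlgCl ℓ ≃+* ℂ) (ρ : Literature.NumberTheory.GaloisRepresentations.FramedGaloisRep K (PadicAlgCl ℓ) n), ρ.toGaloisRep.IsIrreducible → ((∀ᶠ v : IsDedekindDomain.HeightOneSpectrum (NumberField.RingOfIntegers K) in Filter.cofinite, ρ.IsUnramifiedAt v) ∧ ∀ (v : IsDedekindDomain.HeightOneSpectrum (NumberField.RingOfIntegers K)) (hv : ((ℓ : ℕ) : NumberField.RingOfIntegers K) ∈ v.asIdeal), (Literature.NumberTheory.PAdicHodge.fontainePstAdicCompletion v ℓ hv).IsDeRhamFramed (ρ.toLocal v)) → n = 2 → (Set.range fun g : Field.absoluteGaloisGroup K => (ρ g : GL (Fin n) (PadicAlgCl ℓ))).Finite → ¬ ρ.IsOdd → ∀ (ω : Literature.NumberTheory.GaloisRepresentations.HeckeCharacter K), ω.IsUnitary → (∀ v, ω.IsUnramifiedAt v) → ∀ (S : Finset (IsDedekindDomain.HeightOneSpectrum (NumberField.RingOfIntegers K))) (α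 : Literature.NumberTheory.Automorphic.SatakeFamily K), (∀ v ∉ S, ρ.IsUnramifiedAt v ∧ ρ.HasFrobCharpolyAt v (Literature.NumberTheory.Automorphic.arithFrobPolyOfSatake ι v.residueCard 1 (α v))) → ∃ σ₀ : ℝ, (∀ s : ℂ, σ₀ < s.re → Multipliable fun v : {v : IsDedekindDomain.HeightOneSpectrum (NumberField.RingOfIntegers K) // v ∉ S} => ((Literature.NumberTheory.Automorphic.eulerPolynomial ((α v.1).map (· * ω.valueAtUniformizer v.1))).eval ((v.1.residueCard : ℂ) ^ (-s)))⁻¹) ∧ ∃ P : Polynomial ℂ, P ≠ 0 ∧ ∃ g : ℂ → ℂ, Differentiable ℂ g ∧ (∃ C c : ℝ, ∀ s : ℂ, ‖g s‖ ≤ C * Real.exp (‖s‖ ^ c)) ∧ ∀ s : ℂ, σ₀ < s.re → g s = P.eval s * Literature.NumberTheory.Automorphic.partialStandardL (↑S : Set (IsDedekindDomain.HeightOneSpectrum (NumberField.RingOfIntegers K))) (fun v => (α v).map (· * ω.valueAtUniformizer v)) s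

-- parent: NonLimitIrregularAutomorphy · child (gen 1)
/--     item stmt-Langlands-32456 · crux · rank 302 · open
    parent: NonLimitIrregularAutomorphy · by planner
    why it might fail: Print only at K = ℚ (Booker 2003); over TR K ≠ ℚ the unit group is infinite and Booker's residue bookkeeping meets unit-invariant pole configurations / E₂-type pathologies (BK 2014 Rem. 2); BK 2011 Thm 1.1 needs hyp (iv) = twists ENTIRE.
    sources: doi:10.4007/annals.2003.158.1089, doi:10.1112/S0010437X10005087, doi:10.1112/blms/bdt031, doi:10.1093/imrn/rnt127, JacquetLanglands1970, Weissauer1983Converse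
[crux] BOOT · ATTACKABLE-BY-ENGINE (converse-theorem school; print at K = ℚ) · crux (r302 of the
Shape-A split) · BOOT · piece 2 beneath the EQUIV · WEAKER than TAH (trivially; kernel
`bootstrap_of_twisted`) and on a DIFFERENT AXIS from EA: «Booker's theorem for the unramified twist
family over totally real fields» — for every ρ in the box over a totally real K: if EVERY unramified
unitary twist ρ ⊗ ω (ω ∈ Ω_K^nr) has at most finitely many poles (FP-shape), then every such twist
is entire (TAH-shape).  PRINT at K = ℚ (Booker 2003 Thm p.1090: a pole of one Dirichlet twist forces
infinitely many poles of L(s,ρ); with Ω_ℚ^nr = norm twists this is exactly the K = ℚ instance) — a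
THEOREM in a regime where the target (even icosahedral reciprocity over ℚ) is NOT known: the BC5
witness that BOOT is strictly weaker than EA.  OPEN for K ≠ ℚ: Booker–Krishnamurthy, Compositio 147
(2011) Thm 1.1 needs the unramified twists ENTIRE (hyp. (iv), p.670); Bull. LMS 45 (2013) Thm 1.1
(held text paper:doi-10-1112-blms-bdt031 p.2) tolerates only poles killed by a FIXED twisted
Dirichlet polynomial D(s,ω); IMRN 2014 (doi:10.1093/imrn/rnt127) Thm 1.1 — P(s)Λ_f entire of finite
order, nontrivial twists arb -/
@[route_item "route-Langlands-HolomorphicLimitSplit"]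
def UnramifiedPoleBootstrap : Prop :=
  ∀ (K : Type) [Field K] [NumberField K], NumberField.IsTotallyReal K → ∀ (n : ℕ) (ℓ : ℕ) [Fact ℓ.Prime] (ι : PadicAlgCl ℓ ≃+* ℂ) (ρ : Literature.NumberTheory.GaloisRepresentations.FramedGaloisRep K (PadicAlgCl ℓ) n), ρ.toGaloisRep.IsIrreducible → ((∀ᶠ v : IsDedekindDomain.HeightOneSpectrum (NumberField.RingOfIntegers K) in Filter.cofinite, ρ.IsUnramifiedAt v) ∧ ∀ (v : IsDedekindDomain.HeightOneSpectrum (NumberField.RingOfIntegers K)) (hv : ((ℓ : ℕ) : NumberField.RingOfIntegers K) ∈ v.asIdeal), (Literature.NumberTheory.PAdicHodge.fontainePstAdicCompletion v ℓ hv).IsDeRhamFramed (ρ.toLocal v)) → n = 2 → (Set.range fun g : Field.absoluteGaloisGroup K => (ρ g : GL (Fin n) (PadicAlgCl ℓ))).Finite → ¬ ρ.IsOdd → (∀ (ω : Literature.NumberTheory.GaloisRepresentations.HeckeCharacter K), ω.IsUnitary → (∀ v, ω.IsUnramifiedAt v) → ∀ (S : Finset (IsDedekindDomain.HeightOneSpectrum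 (NumberField.RingOfIntegers K))) (α : Literature.NumberTheory.Automorphic.SatakeFamily K), (∀ v ∉ S, ρ.IsUnramifiedAt v ∧ ρ.HasFrobCharpolyAt v (Literature.NumberTheory.Automorphic.arithFrobPolyOfSatake ι v.residueCard 1 (α v))) → ∃ σ₀ : ℝ, (∀ s : ℂ, σ₀ < s.re → Multipliable fun v : {v : IsDedekindDomain.HeightOneSpectrum (NumberField.RingOfIntegers K) // v ∉ S} => ((Literature.NumberTheory.Automorphic.eulerPolynomial ((α v.1).map (· * ω.valueAtUniformizer v.1))).eval ((v.1.residueCard : ℂ) ^ (-s)))⁻¹) ∧ ∃ P : Polynomial ℂ, P ≠ 0 ∧ ∃ g : ℂ → ℂ, Differentiable ℂ g ∧ (∃ C c : ℝ, ∀ s : ℂ, ‖g s‖ ≤ C * Real.exp (‖s‖ ^ c)) ∧ ∀ s : ℂ, σ₀ < s.re → g s = P.eval s * Literature.NumberTheory.Automorphic.partialStandardL (↑S : Set (IsDedekindDomain.HeightOneSpectrum (NumberField.RingOfIntegers K))) (fun v => (α v).map (· * ω.valueAtUniformizer v)) s) → ∀ (ω : Literature.NumberTheory.GaloisRepresentations.HeckeCharacter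 K), ω.IsUnitary → (∀ v, ω.IsUnramifiedAt v) → ∀ (S : Finset (IsDedekindDomain.HeightOneSpectrum (NumberField.RingOfIntegers K))) (α : Literature.NumberTheory.Automorphic.SatakeFamily K), (∀ v ∉ S, ρ.IsUnramifiedAt v ∧ ρ.HasFrobCharpolyAt v (Literature.NumberTheory.Automorphic.arithFrobPolyOfSatake ι v.residueCard 1 (α v))) → ∃ σ₀ : ℝ, (∀ s : ℂ, σ₀ < s.re → Multipliable fun v : {v : IsDedekindDomain.HeightOneSpectrum (NumberField.RingOfIntegers K) // v ∉ S} => ((Literature.NumberTheory.Automorphic.eulerPolynomial ((α v.1).map (· * ω.valueAtUniformizer v.1))).eval ((v.1.residueCard : ℂ) ^ (-s)))⁻¹) ∧ ∃ g : ℂ → ℂ, Differentiable ℂ g ∧ (∃ C c : ℝ, ∀ s : ℂ, ‖g s‖ ≤ C * Real.exp (‖s‖ ^ c)) ∧ ∀ s : ℂ, σ₀ < s.re → g s = Literature.NumberTheory.Automorphic.partialStandardL (↑S : Set (IsDedekindDomain.HeightOneSpectrum (NumberField.RingOfIntegers K))) (fun v => (α v).map (· * ω.valueAtUniformizer v)) 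s

-- parent: NonLimitIrregularAutomorphy · child (gen 1)
/--     item stmt-Langlands-32457 · crux · rank 303 · open
    parent: NonLimitIrregularAutomorphy · by planner
    why it might fail: It is the dark core with the even rank-2 Artin orbit removed: primitive Artin of rank ≥ 3, irregular motives of rank ≥ 5 / HT-multiplicity ≥ 3, non-polarisable irregular ρ over TR K — no engine, no Shimura variety, no converse theorem with GL₁ twists; DECLARED RESIDUAL.
    sources: Calegari2011EvenFM, BuzzardGee2014, Gross2016IncompletenessShimura, Literature.Barriers.Langlands.NonRegularWeightBarrier, Literature.Barriers.Langlands.ShimuraVarietyRealizationBarrier, arXiv:2109.14145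
[crux] NLD · DECLARED RESIDUAL / BARRIER · crux (r303 of the Shape-A split; DECLARED RESIDUAL) · NLD
· child of NL_TR `NonLimitIrregularAutomorphy` 32004 · WEAKER (sub-cell: one more hypothesis `¬
ARTMOVE(ρ)` — ARTMOVE := the parent's MOVE template with `R' HT-regular` replaced by `rank R' = 2 ∧
R' finite image ∧ R' not totally odd`, saturated by construction, so the cell is a union of orbits
of the node's own transports; kernel `nonArtinDark_of_nonLimit`) · DECLARED RESIDUAL / BARRIER
(`Literature.Barriers.Langlands.NonRegularWeightBarrier`, `ShimuraVarietyRealizationBarrier` bite by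
design; no engine in print): primitive Artin representations of rank ≥ 3 with insoluble projective
image (a rank-3 θ cannot sit twisted inside a rank-2 R': no Artin move), non-movable irregular
motives of rank ≥ 5 or Hodge–Tate multiplicity ≥ 3 (generic abelian g-folds g ≥ 3 over TR fields —
census AT15 re-homed —, K3-type orthogonal weight-2 motives (Gross 2016), Calabi–Yau threefolds with
h²'¹ ≥ 2), non-polarisable irregular ρ over TR fields, and the conjecturally EMPTY class of
infinite-image irregular rank-2 ρ even at a real place.  LEFT the residual in g9 (now in EA ∧ AMT):
every ρ related by the -/
@[route_item "route-Langlands-HolomorphicLimitSplit"]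
def NonArtinDarkAutomorphy : Prop :=
  ∀ (K : Type) [Field K] [NumberField K], NumberField.IsTotallyReal K → ∀ (n : ℕ) (hcpt : Literature.NumberTheory.Automorphic.isCompact_glFiniteIntegralLevel n K), 0 < n → ∀ (ℓ : ℕ) [Fact ℓ.Prime] (ι : PadicAlgCl ℓ ≃+* ℂ) (ρ : Literature.NumberTheory.GaloisRepresentations.FramedGaloisRep K (PadicAlgCl ℓ) n), ρ.toGaloisRep.IsIrreducible → ((∀ᶠ v : IsDedekindDomain.HeightOneSpectrum (NumberField.RingOfIntegers K) in Filter.cofinite, ρ.IsUnramifiedAt v) ∧ ∀ (v : IsDedekindDomain.HeightOneSpectrum (NumberField.RingOfIntegers K)) (hv : ((ℓ : ℕ) : NumberField.RingOfIntegers K) ∈ v.asIdeal), (Literature.NumberTheory.PAdicHodge.fontainePstAdicCompletion v ℓ hv).IsDeRhamFramed (ρ.toLocal v)) → ¬ (∃ (M E₀ : Type) (_ : Field M) (_ : NumberField M) (_ : Field E₀) (_ : NumberField E₀) (_ : Algebra K M) (_ : Algebra M E₀) (_ : Algebra K E₀) (_ : IsScalarTower K M E₀) (_ : IsGalois K E₀),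 IsSolvable (E₀ ≃ₐ[K] E₀) ∧ ∃ (F₁ E₁ : Type) (_ : Field F₁) (_ : NumberField F₁) (_ : Field E₁) (_ : NumberField E₁) (_ : Algebra F₁ M) (_ : Algebra M E₁) (_ : Algebra F₁ E₁) (_ : IsScalarTower F₁ M E₁) (_ : IsGalois F₁ E₁), NumberField.IsTotallyReal F₁ ∧ IsSolvable (E₁ ≃ₐ[F₁] E₁) ∧ ∃ (m : ℕ) (θ : Literature.NumberTheory.GaloisRepresentations.FramedGaloisRep M (PadicAlgCl ℓ) m), 0 < m ∧ θ.toGaloisRep.IsIrreducible ∧ (∃ (mc : ℕ) (θc : Literature.NumberTheory.GaloisRepresentations.FramedGaloisRep M (PadicAlgCl ℓ) mc), ∀ g : Field.absoluteGaloisGroup M, Literature.NumberTheory.GaloisRepresentations.FramedRep.trace (ρ.restrictField M) g = Literature.NumberTheory.GaloisRepresentations.FramedRep.trace θ g + Literature.NumberTheory.GaloisRepresentations.FramedRep.trace θc g) ∧ ∃ (χ : Literature.NumberTheory.GaloisRepresentations.FramedGaloisRep M (PadicAlgCl ℓ) 1) (n' : ℕ) (R' : Literature.NumberTheory.GaloisRepresentations.FramedGaloisRep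 F₁ (PadicAlgCl ℓ) n'), 0 < n' ∧ R'.toGaloisRep.IsIrreducible ∧ ((∀ᶠ v : IsDedekindDomain.HeightOneSpectrum (NumberField.RingOfIntegers F₁) in Filter.cofinite, R'.IsUnramifiedAt v) ∧ ∀ (v : IsDedekindDomain.HeightOneSpectrum (NumberField.RingOfIntegers F₁)) (hv : ((ℓ : ℕ) : NumberField.RingOfIntegers F₁) ∈ v.asIdeal), (Literature.NumberTheory.PAdicHodge.fontainePstAdicCompletion v ℓ hv).IsDeRhamFramed (R'.toLocal v)) ∧ (∀ (v : IsDedekindDomain.HeightOneSpectrum (NumberField.RingOfIntegers F₁)) (hv : ((ℓ : ℕ) : NumberField.RingOfIntegers F₁) ∈ v.asIdeal), ∀ τ : v.adicCompletion F₁ →+* PadicAlgCl ℓ, Continuous τ → (R'.labelledHodgeTateWeightsAt v (Literature.NumberTheory.PAdicHodge.fontainePstAdicCompletion v ℓ hv).algebra (Literature.NumberTheory.PAdicHodge.fontainePstAdicCompletion v ℓ hv).𝔅 τ).Nodup) ∧ (∃ (mc' : ℕ) (θc' : Literature.NumberTheory.GaloisRepresentations.FramedGaloisRep M (PadicAlgCl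 ℓ) mc'), ∀ g : Field.absoluteGaloisGroup M, Literature.NumberTheory.GaloisRepresentations.FramedRep.trace (R'.restrictField M) g = Literature.NumberTheory.GaloisRepresentations.FramedRep.trace χ g * Literature.NumberTheory.GaloisRepresentations.FramedRep.trace θ g + Literature.NumberTheory.GaloisRepresentations.FramedRep.trace θc' g)) → ¬ (∃ (M E₀ : Type) (_ : Field M) (_ : NumberField M) (_ : Field E₀) (_ : NumberField E₀) (_ : Algebra K M) (_ : Algebra M E₀) (_ : Algebra K E₀) (_ : IsScalarTower K M E₀) (_ : IsGalois K E₀), IsSolvable (E₀ ≃ₐ[K] E₀) ∧ ∃ (F₁ E₁ : Type) (_ : Field F₁) (_ : NumberField F₁) (_ : Field E₁) (_ : NumberField E₁) (_ : Algebra F₁ M) (_ : Algebra M E₁) (_ : Algebra F₁ E₁) (_ : IsScalarTower F₁ M E₁) (_ : IsGalois F₁ E₁), NumberField.IsTotallyReal F₁ ∧ IsSolvable (E₁ ≃ₐ[F₁] E₁) ∧ ∃ (m : ℕ) (θ : Literature.NumberTheory.GaloisRepresentations.FramedGaloisRep M (PadicAlgCl ℓ) m), 0 < m ∧ θ.toGaloisRep.IsIrreducible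 ∧ (∃ (mc : ℕ) (θc : Literature.NumberTheory.GaloisRepresentations.FramedGaloisRep M (PadicAlgCl ℓ) mc), ∀ g : Field.absoluteGaloisGroup M, Literature.NumberTheory.GaloisRepresentations.FramedRep.trace (ρ.restrictField M) g = Literature.NumberTheory.GaloisRepresentations.FramedRep.trace θ g + Literature.NumberTheory.GaloisRepresentations.FramedRep.trace θc g) ∧ ∃ (χ : Literature.NumberTheory.GaloisRepresentations.FramedGaloisRep M (PadicAlgCl ℓ) 1) (n' : ℕ) (R' : Literature.NumberTheory.GaloisRepresentations.FramedGaloisRep F₁ (PadicAlgCl ℓ) n'), 0 < n' ∧ R'.toGaloisRep.IsIrreducible ∧ ((∀ᶠ v : IsDedekindDomain.HeightOneSpectrum (NumberField.RingOfIntegers F₁) in Filter.cofinite, R'.IsUnramifiedAt v) ∧ ∀ (v : IsDedekindDomain.HeightOneSpectrum (NumberField.RingOfIntegers F₁)) (hv : ((ℓ : ℕ) : NumberField.RingOfIntegers F₁) ∈ v.asIdeal), (Literature.NumberTheory.PAdicHodge.fontainePstAdicCompletion v ℓ hv).IsDeRhamFramed (R'.toLocal v)) ∧ n' ≤ 4 ∧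 (∃ B : Matrix (Fin n') (Fin n') (PadicAlgCl ℓ), B.det ≠ 0 ∧ (Matrix.transpose B = B ∨ Matrix.transpose B = -B) ∧ (∀ g : Field.absoluteGaloisGroup F₁, ∃ s : PadicAlgCl ℓ, Matrix.transpose ((R' g : GL (Fin n') (PadicAlgCl ℓ)) : Matrix (Fin n') (Fin n') (PadicAlgCl ℓ)) * B * ((R' g : GL (Fin n') (PadicAlgCl ℓ)) : Matrix (Fin n') (Fin n') (PadicAlgCl ℓ)) = s • B) ∧ ∀ (φ : F₁ →+* ℝ) (c : Field.absoluteGaloisGroup F₁), Literature.NumberTheory.GaloisRepresentations.IsComplexConjugation φ c → Matrix.transpose (B * ((R' c : GL (Fin n') (PadicAlgCl ℓ)) : Matrix (Fin n') (Fin n') (PadicAlgCl ℓ))) = B * ((R' c : GL (Fin n') (PadicAlgCl ℓ)) : Matrix (Fin n') (Fin n') (PadicAlgCl ℓ))) ∧ (∀ (v : IsDedekindDomain.HeightOneSpectrum (NumberField.RingOfIntegers F₁)) (hv : ((ℓ : ℕ) : NumberField.RingOfIntegers F₁) ∈ v.asIdeal), ∀ τ : v.adicCompletion F₁ →+* PadicAlgCl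 ℓ, Continuous τ → ∀ w : ℤ, Multiset.count w (R'.labelledHodgeTateWeightsAt v (Literature.NumberTheory.PAdicHodge.fontainePstAdicCompletion v ℓ hv).algebra (Literature.NumberTheory.PAdicHodge.fontainePstAdicCompletion v ℓ hv).𝔅 τ) ≤ 2) ∧ (∃ (mc' : ℕ) (θc' : Literature.NumberTheory.GaloisRepresentations.FramedGaloisRep M (PadicAlgCl ℓ) mc'), ∀ g : Field.absoluteGaloisGroup M, Literature.NumberTheory.GaloisRepresentations.FramedRep.trace (R'.restrictField M) g = Literature.NumberTheory.GaloisRepresentations.FramedRep.trace χ g * Literature.NumberTheory.GaloisRepresentations.FramedRep.trace θ g + Literature.NumberTheory.GaloisRepresentations.FramedRep.trace θc' g)) → ¬ (∃ (M E₀ : Type) (_ : Field M) (_ : NumberField M) (_ : Field E₀) (_ : NumberField E₀) (_ : Algebra K M) (_ : Algebra M E₀) (_ : Algebra K E₀) (_ : IsScalarTower K M E₀) (_ : IsGalois K E₀), IsSolvable (E₀ ≃ₐ[K] E₀) ∧ ∃ (F₁ E₁ : Type) (_ : Field F₁) (_ : NumberField F₁) (_ : Field E₁) (_ : NumberField E₁)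 (_ : Algebra F₁ M) (_ : Algebra M E₁) (_ : Algebra F₁ E₁) (_ : IsScalarTower F₁ M E₁) (_ : IsGalois F₁ E₁), NumberField.IsTotallyReal F₁ ∧ IsSolvable (E₁ ≃ₐ[F₁] E₁) ∧ ∃ (m : ℕ) (θ : Literature.NumberTheory.GaloisRepresentations.FramedGaloisRep M (PadicAlgCl ℓ) m), 0 < m ∧ θ.toGaloisRep.IsIrreducible ∧ (∃ (mc : ℕ) (θc : Literature.NumberTheory.GaloisRepresentations.FramedGaloisRep M (PadicAlgCl ℓ) mc), ∀ g : Field.absoluteGaloisGroup M, Literature.NumberTheory.GaloisRepresentations.FramedRep.trace (ρ.restrictField M) g = Literature.NumberTheory.GaloisRepresentations.FramedRep.trace θ g + Literature.NumberTheory.GaloisRepresentations.FramedRep.trace θc g) ∧ ∃ (χ : Literature.NumberTheory.GaloisRepresentations.FramedGaloisRep M (PadicAlgCl ℓ) 1) (n' : ℕ) (R' : Literature.NumberTheory.GaloisRepresentations.FramedGaloisRep F₁ (PadicAlgCl ℓ) n'), 0 < n' ∧ R'.toGaloisRep.IsIrreducible ∧ ((∀ᶠ v : IsDedekindDomain.HeightOneSpectrum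 (NumberField.RingOfIntegers F₁) in Filter.cofinite, R'.IsUnramifiedAt v) ∧ ∀ (v : IsDedekindDomain.HeightOneSpectrum (NumberField.RingOfIntegers F₁)) (hv : ((ℓ : ℕ) : NumberField.RingOfIntegers F₁) ∈ v.asIdeal), (Literature.NumberTheory.PAdicHodge.fontainePstAdicCompletion v ℓ hv).IsDeRhamFramed (R'.toLocal v)) ∧ n' = 2 ∧ (Set.range fun g : Field.absoluteGaloisGroup F₁ => (R' g : GL (Fin n') (PadicAlgCl ℓ))).Finite ∧ ¬ R'.IsOdd ∧ (∃ (mc' : ℕ) (θc' : Literature.NumberTheory.GaloisRepresentations.FramedGaloisRep M (PadicAlgCl ℓ) mc'), ∀ g : Field.absoluteGaloisGroup M, Literature.NumberTheory.GaloisRepresentations.FramedRep.trace (R'.restrictField M) g = Literature.NumberTheory.GaloisRepresentations.FramedRep.trace χ g * Literature.NumberTheory.GaloisRepresentations.FramedRep.trace θ g + Literature.NumberTheory.GaloisRepresentations.FramedRep.trace θc' g)) → ∃ π : Literature.NumberTheory.Automorphic.CuspidalAutomorphicRepData n K hcpt, π.1.IsLAlgebraic ∧ ∀ᶠ v : IsDedekindDomain.HeightOneSpectrum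 (NumberField.RingOfIntegers K) in Filter.cofinite, SatakeFrobCompatibleAt ι π.1 ρ v

-- parent: NonLimitIrregularAutomorphy · child (gen 1)
/--     item stmt-Langlands-32458 · support · rank 304 · open
    parent: NonLimitIrregularAutomorphy · by planner
    sources: doi:10.1112/S0010437X10005087, Literature.NumberTheory.Automorphic.bookerKrishnamurthy_isPiOfArtinRep_of_entire_twists, JacquetLanglands1970, Brauer1947, Hecke1937
[support] JLBK · PRINT (Booker–Krishnamurthy Cor 1.2 + Jacquet–Langlands 10.10 + Brauer–Hecke
bookkeeping) · support (r304 of the Shape-A split) · JLBK · PRINT · the ⟸ half of THE ONE EQUIV: for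
ρ in the box over a totally real K, if the partial L-functions of ALL unramified unitary twists ρ ⊗
ω are restrictions of entire functions of finite order (TAH-shape), then ρ is weakly automorphic
(cuspidal L-algebraic π on GL₂(𝔸_K), Satake–Frobenius compatible a.e.).  Sources:
Booker–Krishnamurthy, Compositio 147 (2011) Thm 1.1 (i)–(iv) and Cor 1.2 p.670 (held text
paper:doi-10-1112-s0010437x10005087; tree fact
`Literature.NumberTheory.Automorphic.bookerKrishnamurthy_isPiOfArtinRep_of_entire_twists` over the
`FramedArtinRep` carrier — the finite-image ℓ-adic ρ composed with ι IS a continuous complex Artin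
representation); meromorphy + functional equation of ALL twists from Brauer 1947 + Hecke/Tate; Λ
entire ⟸ L^S entire (S ⊇ Ram ρ: Λ = L^S · ∏_{v ∈ S} L_v · L_∞ has its poles a priori in 0 ≤ re s ≤
1, none on re s = 0, 1 by Hecke non-vanishing + the functional equation, and inside the open strip
L_v, L_∞ are pole-free); cuspidality of π by Jacquet–Langlands Thm 10.10 (BK 2011 Remark (i)); L -/
@[route_item "route-Langlands-HolomorphicLimitSplit"]
def ArtinConverseDictionary : Prop :=
  ∀ (K : Type) [Field K] [NumberField K], NumberField.IsTotallyReal K → ∀ (n : ℕ) (ℓ : ℕ) [Fact ℓ.Prime] (ι : PadicAlgCl ℓ ≃+* ℂ) (ρ : Literature.NumberTheory.GaloisRepresentations.FramedGaloisRep K (PadicAlgCl ℓ) n), ρ.toGaloisRep.IsIrreducible → ((∀ᶠ v : IsDedekindDomain.HeightOneSpectrum (NumberField.RingOfIntegers K) in Filter.cofinite, ρ.IsUnramifiedAt v) ∧ ∀ (v : IsDedekindDomain.HeightOneSpectrum (NumberField.RingOfIntegers K)) (hv : ((ℓ : ℕ) : NumberField.RingOfIntegers K) ∈ v.asIdeal),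 (Literature.NumberTheory.PAdicHodge.fontainePstAdicCompletion v ℓ hv).IsDeRhamFramed (ρ.toLocal v)) → n = 2 → (Set.range fun g : Field.absoluteGaloisGroup K => (ρ g : GL (Fin n) (PadicAlgCl ℓ))).Finite → ¬ ρ.IsOdd → (∀ (ω : Literature.NumberTheory.GaloisRepresentations.HeckeCharacter K), ω.IsUnitary → (∀ v, ω.IsUnramifiedAt v) → ∀ (S : Finset (IsDedekindDomain.HeightOneSpectrum (NumberField.RingOfIntegers K))) (α : Literature.NumberTheory.Automorphic.SatakeFamily K), (∀ v ∉ S, ρ.IsUnramifiedAt v ∧ ρ.HasFrobCharpolyAt v (Literature.NumberTheory.Automorphic.arithFrobPolyOfSatake ι v.residueCard 1 (α v))) → ∃ σ₀ : ℝ, (∀ s : ℂ, σ₀ < s.re → Multipliable fun v : {v : IsDedekindDomain.HeightOneSpectrum (NumberField.RingOfIntegers K) // v ∉ S} => ((Literature.NumberTheory.Automorphic.eulerPolynomial ((α v.1).map (· * ω.valueAtUniformizer v.1))).eval ((v.1.residueCard : ℂ) ^ (-s)))⁻¹) ∧ ∃ g : ℂ → ℂ, Differentiable ℂ g ∧ (∃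 C c : ℝ, ∀ s : ℂ, ‖g s‖ ≤ C * Real.exp (‖s‖ ^ c)) ∧ ∀ s : ℂ, σ₀ < s.re → g s = Literature.NumberTheory.Automorphic.partialStandardL (↑S : Set (IsDedekindDomain.HeightOneSpectrum (NumberField.RingOfIntegers K))) (fun v => (α v).map (· * ω.valueAtUniformizer v)) s) → ∀ hcpt : Literature.NumberTheory.Automorphic.isCompact_glFiniteIntegralLevel n K, ∃ π : Literature.NumberTheory.Automorphic.CuspidalAutomorphicRepData n K hcpt, π.1.IsLAlgebraic ∧ ∀ᶠ v : IsDedekindDomain.HeightOneSpectrum (NumberField.RingOfIntegers K) in Filter.cofinite, SatakeFrobCompatibleAt ι π.1 ρ v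

-- parent: NonLimitIrregularAutomorphy · child (gen 1)
/--     item stmt-Langlands-32459 · support · rank 305 · open
    parent: NonLimitIrregularAutomorphy · by planner
    sources: ArthurClozelAMS120, BuzzardGee2014, SerreLinearRepresentations1977
[support] AMT · closes from MT ∧ W⁺ (kernel `artinMoveTransport_of_moveTransport`) · support (r305
of the Shape-A split) · AMT · the seam of the split · WEAKER than MT ∘ W⁺ (kernel
`artinMoveTransport_of_moveTransport : SatakeAvatarExistence → RegularizingMoveTransport →
ArtinMoveTransport`; = the parent's `RegularizingMoveTransport` with the W⁺ prefix dropped and the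
hypotheses `F₁ totally real`, `rank R' = 2`, `R' finite image`, `R' not totally odd` added): weak
automorphy is transported BACK along one Artin move — R' automorphic over F₁ ⇒ θ ⊗ χ automorphic
over M (solvable Galois ascent S1 along E₁/F₁) ⇒ θ automorphic (untwist) ⇒ ρ automorphic over K (S1
along E₀/M, Clifford descent S2 along E₀/K) [Arthur–Clozel III.4.2, III.5.1, III.6.2; needs the
Satake avatars W⁺ = `SatakeAvatarExistence` 17415 for the Brauer–Nesbitt bookkeeping — for
Maass-type π the avatars are NOT in print, which is why this is a support closing with MT ∧ W⁺ and
not print-now].  Not a binder of the deciding theorem (derived inside `closes_artin`).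
Langlands-implied (`artinMoveTransport_of_weak`). [TAGS: RESIDUAL MODE node lens-3-g9
ArtinAnalyticSplit (bus L507; layer-2 --split of NL_TR = NonLimitIrregular -/
@[route_item "route-Langlands-HolomorphicLimitSplit"]
def ArtinMoveTransport : Prop :=
  ∀ (F₀ : Type) [Field F₀] [NumberField F₀] (n : ℕ) (ℓ : ℕ) [Fact ℓ.Prime] (ι : PadicAlgCl ℓ ≃+* ℂ) (R : Literature.NumberTheory.GaloisRepresentations.FramedGaloisRep F₀ (PadicAlgCl ℓ) n), R.toGaloisRep.IsIrreducible → ((∀ᶠ v : IsDedekindDomain.HeightOneSpectrum (NumberField.RingOfIntegers F₀) in Filter.cofinite, R.IsUnramifiedAt v) ∧ ∀ (v : IsDedekindDomain.HeightOneSpectrum (NumberField.RingOfIntegers F₀)) (hv : ((ℓ : ℕ) : NumberField.RingOfIntegers F₀) ∈ v.asIdeal), (Literature.NumberTheory.PAdicHodge.fontainePstAdicCompletion v ℓ hv).IsDeRhamFramed (R.toLocal v)) → 0 < n → ∀ (K E₀ : Type) [Field K] [NumberField K] [Field E₀] [NumberField E₀] [Algebra F₀ K] [Algebra K E₀] [Algebra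 F₀ E₀] [IsScalarTower F₀ K E₀] [IsGalois F₀ E₀], IsSolvable (E₀ ≃ₐ[F₀] E₀) → ∀ (F₁ E₁ : Type) [Field F₁] [NumberField F₁] [Field E₁] [NumberField E₁] [Algebra F₁ K] [Algebra K E₁] [Algebra F₁ E₁] [IsScalarTower F₁ K E₁] [IsGalois F₁ E₁], IsSolvable (E₁ ≃ₐ[F₁] E₁) → NumberField.IsTotallyReal F₁ → ∀ (m : ℕ) (θ : Literature.NumberTheory.GaloisRepresentations.FramedGaloisRep K (PadicAlgCl ℓ) m), 0 < m → θ.toGaloisRep.IsIrreducible → (∃ (mc : ℕ) (θc : Literature.NumberTheory.GaloisRepresentations.FramedGaloisRep K (PadicAlgCl ℓ) mc), ∀ g : Field.absoluteGaloisGroup K, Literature.NumberTheory.GaloisRepresentations.FramedRep.trace (R.restrictField K) g = Literature.NumberTheory.GaloisRepresentations.FramedRep.trace θ g + Literature.NumberTheory.GaloisRepresentations.FramedRep.trace θc g) → ∀ (χ : Literature.NumberTheory.GaloisRepresentations.FramedGaloisRep K (PadicAlgCl ℓ) 1) (n' : ℕ) (R' : Literature.NumberTheory.GaloisRepresentations.FramedGaloisRep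 F₁ (PadicAlgCl ℓ) n'), 0 < n' → R'.toGaloisRep.IsIrreducible → ((∀ᶠ v : IsDedekindDomain.HeightOneSpectrum (NumberField.RingOfIntegers F₁) in Filter.cofinite, R'.IsUnramifiedAt v) ∧ ∀ (v : IsDedekindDomain.HeightOneSpectrum (NumberField.RingOfIntegers F₁)) (hv : ((ℓ : ℕ) : NumberField.RingOfIntegers F₁) ∈ v.asIdeal), (Literature.NumberTheory.PAdicHodge.fontainePstAdicCompletion v ℓ hv).IsDeRhamFramed (R'.toLocal v)) → n' = 2 → (Set.range fun g : Field.absoluteGaloisGroup F₁ => (R' g : GL (Fin n') (PadicAlgCl ℓ))).Finite → ¬ R'.IsOdd → (∃ (mc' : ℕ) (θc' : Literature.NumberTheory.GaloisRepresentations.FramedGaloisRep K (PadicAlgCl ℓ) mc'), ∀ g : Field.absoluteGaloisGroup K, Literature.NumberTheory.GaloisRepresentations.FramedRep.trace (R'.restrictField K) g = Literature.NumberTheory.GaloisRepresentations.FramedRep.trace χ g * Literature.NumberTheory.GaloisRepresentations.FramedRep.trace θ g + Literature.NumberTheory.GaloisRepresentations.FramedRep.trace θc' g) → (∀ hcpt'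 : Literature.NumberTheory.Automorphic.isCompact_glFiniteIntegralLevel n' F₁, ∃ π : Literature.NumberTheory.Automorphic.CuspidalAutomorphicRepData n' F₁ hcpt', π.1.IsLAlgebraic ∧ ∀ᶠ v : IsDedekindDomain.HeightOneSpectrum (NumberField.RingOfIntegers F₁) in Filter.cofinite, SatakeFrobCompatibleAt ι π.1 R' v) → ∀ hcpt : Literature.NumberTheory.Automorphic.isCompact_glFiniteIntegralLevel n F₀, ∃ π : Literature.NumberTheory.Automorphic.CuspidalAutomorphicRepData n F₀ hcpt, π.1.IsLAlgebraic ∧ ∀ᶠ v : IsDedekindDomain.HeightOneSpectrum (NumberField.RingOfIntegers F₀) in Filter.cofinite, SatakeFrobCompatibleAt ι π.1 R v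

-- parent: NonLimitIrregularAutomorphy · glue (gen 1)
/--     item stmt-Langlands-32460 · support · rank 306 · closed · proved by Summit.Langlands.Langlands.Theorems.NonLimitIrregularAutomorphy_of_artinsplit_proof (prover)
    parent: NonLimitIrregularAutomorphy · GLUE: children ⟹ parent · by planner
TwistedArtinFinitePoles → UnramifiedPoleBootstrap → NonArtinDarkAutomorphy → ArtinConverseDictionary
→ ArtinMoveTransport → NonLimitIrregularAutomorphy — pure logic: excluded middle on the inlined
ARTIN-MOVE dial ARTMOVE(ρ/K) (the parent MOVE template with «R′ HT-regular» replaced by «rank R′ = 2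
∧ R′ finite image ∧ R′ not totally odd»); no Artin move ⇒ NonArtinDarkAutomorphy verbatim; else the
even-Artin avatar R′ over the totally real F₁ has finitely many poles in every unramified unitary
twist (TwistedArtinFinitePoles) ⇒ entire twists (UnramifiedPoleBootstrap) ⇒ weak automorphy of R′
(ArtinConverseDictionary) and ArtinMoveTransport carries it back to ρ (lens-3-g9 node kernel
nonLimit_of_analyticSplit, 0 sorry; certified as NonLimitIrregularAutomorphy_of_artinsplit_proof in
nodes/lens-3-g9-ArtinAnalyticSplit.split_glue.lean, mock kit_check_split.lean rc0 against the born
host module) -/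
@[route_item "route-Langlands-HolomorphicLimitSplit"]
def NonLimitIrregularAutomorphy_of_artinsplit : Prop :=
  TwistedArtinFinitePoles → UnramifiedPoleBootstrap → NonArtinDarkAutomorphy → ArtinConverseDictionary → ArtinMoveTransport → NonLimitIrregularAutomorphy

-- `NonLimitIrregularAutomorphy_of_artinsplit` holds: proved by `Summit.Langlands.Langlands.Theorems.NonLimitIrregularAutomorphy_of_artinsplit_proof` (its module imports this route file, so no `_holds` link can be stated here).

/-- item stmt-Langlands-31692 · crux · rank 4 · open · by planner
why it might fail: no construction of Galois representations, no Shimura variety and no solvable path to one over such K; simple-group base change for GL_n is wide open (Getz); nothing beyond n = 1 and solvable-image Artin is decided.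
sources: ArthurClozelAMS120, Rajan2002, Getz2012, Literature.Barriers.Langlands.ShimuraVarietyRealizationBarrier
[crux] [crux] B_CI — the CONJUGATION-INSOLUBLE CELL of B_w (DECLARED RESIDUAL #2; WEAKER than B_w
outright, kernel `conjugationInsoluble_of_weak`; exact cell cut `weak_iff_cells`): for every number
field K which lies in NO solvable Galois extension of a totally real field (¬CS K, the negation of
route BaseFieldAscent's conjugation-solvable class, typed verbatim), n ≥ 1, hcpt, (ℓ, ι), every
irreducible geometric ρ : Γ_K → GL_n(ℚ̄_ℓ) is weakly automorphic. Dark by design: mixed signature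
AND insoluble closure over the maximal totally real subfield (generic quintic and higher over a TR
field); print inside = n = 1 (class field theory) and Artin representations with solvable image
(Langlands–Tunnell over any base); needs base change / descent along extensions with simple
non-abelian group (= BaseFieldAscent.AscentResidual territory). [difficulty: open-problem]
[difficulty: open-problem] [TAGS: RESIDUAL MODE node lens-3-g7 WeilRestrictionSplit (bus L405;
sibling root-level route over the N0 PrimeSwitchSplit frame re-cutting B_w = WeakGeometricAutomorphy
stmt-Langlands-17414), crit-1 CLEARED 2026-08-30T09:11:16Z STATUS L423 (CRITIC-LEDGER row 89; errata
e1 docblock-only, advisories a2/a3 -/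
@[route_item "route-Langlands-HolomorphicLimitSplit", crux]
def ConjugationInsolubleAutomorphy : Prop :=
  ∀ (K : Type) [Field K] [NumberField K], ¬ (∃ (F₀ E : Type) (_ : Field F₀) (_ : NumberField F₀) (_ : Field E) (_ : NumberField E) (_ : Algebra F₀ K) (_ : Algebra K E) (_ : Algebra F₀ E) (_ : IsScalarTower F₀ K E) (_ : IsGalois F₀ E), NumberField.IsTotallyReal F₀ ∧ IsSolvable (E ≃ₐ[F₀] E)) → ∀ (n : ℕ) (hcpt : Literature.NumberTheory.Automorphic.isCompact_glFiniteIntegralLevel n K), 0 < n → ∀ (ℓ : ℕ) [Fact ℓ.Prime] (ι : PadicAlgCl ℓ ≃+* ℂ) (ρ : Literature.NumberTheory.GaloisRepresentations.FramedGaloisRep K (PadicAlgCl ℓ) n), ρ.toGaloisRep.IsIrreducible → ((∀ᶠ v : IsDedekindDomain.HeightOneSpectrum (NumberField.RingOfIntegers K) in Filter.cofinite, ρ.IsUnramifiedAt v) ∧ ∀ (v : IsDedekindDomain.HeightOneSpectrum (NumberField.RingOfIntegers K)) (hv : ((ℓ : ℕ) : NumberField.RingOfIntegers K) ∈ v.asIdeal),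 (Literature.NumberTheory.PAdicHodge.fontainePstAdicCompletion v ℓ hv).IsDeRhamFramed (ρ.toLocal v)) → ∃ π : Literature.NumberTheory.Automorphic.CuspidalAutomorphicRepData n K hcpt, π.1.IsLAlgebraic ∧ ∀ᶠ v : IsDedekindDomain.HeightOneSpectrum (NumberField.RingOfIntegers K) in Filter.cofinite, SatakeFrobCompatibleAt ι π.1 ρ v

/-- item stmt-Langlands-31693 · crux · rank 5 · open · by planner
why it might fail: residual automorphy (Serre-type conjectures over totally real fields, GSp₄ and beyond) and non-polarizable regular ρ of rank ≥ 3 have no engine; Fontaine–Mazur for GL₂ is complete only over ℚ and only for ℓ ≥ 5 generic residual image.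
sources: Kisin2009FM, arXiv:1901.07166, Calegari2011EvenFM, BarnetlambEtAl2014, arXiv:1812.09269
[crux] [crux] REG_TR — HODGE–TATE-REGULAR AUTOMORPHY OVER TOTALLY REAL FIELDS (ATTACKABLE leaf;
WEAKER than B_w outright, kernel `regularTotallyReal_of_weak`): for every totally real K, n ≥ 1,
hcpt, (ℓ, ι) and every irreducible geometric ρ : Γ_K → GL_n(ℚ̄_ℓ) whose labelled Hodge–Tate weights
are DISTINCT at every place v ∣ ℓ and every embedding (`(ρ.labelledHodgeTateWeightsAt v … τ).Nodup`,
the tree's typing from route ParityLadder), ρ is weakly automorphic. Print sector: n = 1 (CFT); n =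
2 odd over ℚ (Kisin, Emerton, Pan: Fontaine–Mazur), even regular over ℚ void for ℓ > 7 (Calegari); n
= 2 over TR fields and n ≥ 3 polarizable: modularity lifting + potential automorphy boxes (BLGGT,
10-author over CM via induction); residual boxes AT2 (GL₂, ℓ ≤ 7 / residually degenerate), AT10
(non-polarizable n ≥ 3), residual modularity over TR fields (BDJ-Serre). [difficulty: open-problem]
[difficulty: open-problem] [TAGS: RESIDUAL MODE node lens-3-g7 WeilRestrictionSplit (bus L405;
sibling root-level route over the N0 PrimeSwitchSplit frame re-cutting B_w = WeakGeometricAutomorphy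
stmt-Langlands-17414), crit-1 CLEARED 2026-08-30T09:11:16Z STATUS L423 (CRITIC-LEDGER row 89; errata
e1 docblock-on -/
@[route_item "route-Langlands-HolomorphicLimitSplit", crux]
def RegularTotallyRealAutomorphy : Prop :=
  ∀ (K : Type) [Field K] [NumberField K], NumberField.IsTotallyReal K → ∀ (n : ℕ) (hcpt : Literature.NumberTheory.Automorphic.isCompact_glFiniteIntegralLevel n K), 0 < n → ∀ (ℓ : ℕ) [Fact ℓ.Prime] (ι : PadicAlgCl ℓ ≃+* ℂ) (ρ : Literature.NumberTheory.GaloisRepresentations.FramedGaloisRep K (PadicAlgCl ℓ) n), ρ.toGaloisRep.IsIrreducible → ((∀ᶠ v : IsDedekindDomain.HeightOneSpectrum (NumberField.RingOfIntegers K) in Filter.cofinite, ρ.IsUnramifiedAt v) ∧ ∀ (v : IsDedekindDomain.HeightOneSpectrum (NumberField.RingOfIntegers K)) (hv : ((ℓ : ℕ) : NumberField.RingOfIntegers K) ∈ v.asIdeal), (Literature.NumberTheory.PAdicHodge.fontainePstAdicCompletion v ℓ hv).IsDeRhamFramed (ρ.toLocal v)) → (∀ (v : IsDedekindDomain.HeightOneSpectrum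 (NumberField.RingOfIntegers K)) (hv : ((ℓ : ℕ) : NumberField.RingOfIntegers K) ∈ v.asIdeal), ∀ τ : v.adicCompletion K →+* PadicAlgCl ℓ, Continuous τ → (ρ.labelledHodgeTateWeightsAt v (Literature.NumberTheory.PAdicHodge.fontainePstAdicCompletion v ℓ hv).algebra (Literature.NumberTheory.PAdicHodge.fontainePstAdicCompletion v ℓ hv).𝔅 τ).Nodup) → ∃ π : Literature.NumberTheory.Automorphic.CuspidalAutomorphicRepData n K hcpt, π.1.IsLAlgebraic ∧ ∀ᶠ v : IsDedekindDomain.HeightOneSpectrum (NumberField.RingOfIntegers K) in Filter.cofinite, SatakeFrobCompatibleAt ι π.1 ρ v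

/-- item stmt-Langlands-17415 · crux · rank 6 · open · by planner
why it might fail: no construction of ρ for irregular L-algebraic π (Maass λ = ¼, non-cohomological weights) or for K neither totally real nor CM; irreducibility open for n ≥ 3 outside polarized / density-one cases.
sources: BuzzardGee2014, HarrisLanTaylorThorneRMS2016, Scholze2015
[crux] W⁺ — for every number field K, n ≥ 1, every L-algebraic cuspidal π of GL_n(𝔸_K) and every (ℓ,
ι) there is an IRREDUCIBLE ρ : Γ_K → GL_n(ℚ̄_ℓ) Satake–Frobenius compatible with (π, ι) at almost
all places (Buzzard–Gee Conj. 3.2.2 weak form + Ramakrishnan's cuspidal ⇒ irreducible; Clozel's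
Conj. 1.1.1 in arXiv:2607.11763). No de Rham clause, no Rec: ε-free and Rec-free. [difficulty:
open-problem] -/
@[route_item "route-Langlands-HolomorphicLimitSplit", crux]
def SatakeAvatarExistence : Prop :=
  ∀ (K : Type) [Field K] [NumberField K] (n : ℕ) (hcpt : Literature.NumberTheory.Automorphic.isCompact_glFiniteIntegralLevel n K), 0 < n → ∀ (π : Literature.NumberTheory.Automorphic.CuspidalAutomorphicRepData n K hcpt), π.1.IsLAlgebraic → ∀ (ℓ : ℕ) [Fact ℓ.Prime] (ι : PadicAlgCl ℓ ≃+* ℂ), ∃ ρ : Literature.NumberTheory.GaloisRepresentations.FramedGaloisRep K (PadicAlgCl ℓ) n, ρ.toGaloisRep.IsIrreducible ∧ ∀ᶠ v : IsDedekindDomain.HeightOneSpectrum (NumberField.RingOfIntegers K) in cofinite, SatakeFrobCompatibleAt ι π.1 ρ v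

/-- item stmt-Langlands-17534 · crux · rank 7 · open · by planner
why it might fail: local–global compatibility at v ∣ ℓ for non-polarizable π over general K is known only up to semisimplification/monodromy in the CM case (ACC+, torsion classes); de Rhamness of ρ_π at ℓ open for irregular π.
sources: ACC2023, Caraiani2014, BarnetlambEtAl2014, arXiv:2109.14145
[crux] P — the PRIME-SWITCH PRINCIPLE for the p-adic member of the automorphic compatible system
(Rec-parametric, Rec-free in content; rev 1, cone repair: stated over the summit's own predicates
only): for π L-algebraic cuspidal on GL_n/K, ρ an irreducible ℓ-adic avatar of (π, ι)
(Satake–Frobenius compatible a.e.) and a place v ∣ ℓ: (i) ρ|_v is de Rham for Fontaine's pinned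
datum; (ii) for EVERY reciprocity datum Rec, every prime ℓ' ∤ v, ι' and every irreducible ℓ'-adic
avatar ρ' of (π, ι'), local–global compatibility of (π, ρ') at v for Rec (read ℓ'-adically,
Grothendieck–Deligne) implies local–global compatibility of (π, ρ) at v for Rec (read through
D_pst). Mathematically (ii) is Fontaine's C_WD for the system {ρ_(π,ι)}: the
Frobenius-semisimplified Weil–Deligne representation at v of the p-adic member, computed by D_pst,
is the common one of the ℓ'-adic members (Saito arXiv:math/0612077 for Hilbert modular forms;
Caraiani 2012/2014 for Shimura varieties; AHTW 2026 Thm 1.2.1 up to semisimplification for regular π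
over CM). Kernel-certified consequence of `Langlands` (bc/SubsOfLanglands.lean); with L∤ at (π, ι',
ρ') it is Taylor's Conj. 7 at v ∣ ℓ — the glue's patching lemma. -/
@[route_item "route-Langlands-HolomorphicLimitSplit", crux]
def PadicMemberCompatibility : Prop :=
  ∀ (K : Type) [Field K] [NumberField K] (n : ℕ) (hcpt : Literature.NumberTheory.Automorphic.isCompact_glFiniteIntegralLevel n K), 0 < n → ∀ (π : Literature.NumberTheory.Automorphic.CuspidalAutomorphicRepData n K hcpt), π.1.IsLAlgebraic → ∀ (ℓ : ℕ) [Fact ℓ.Prime] (ι : PadicAlgCl ℓ ≃+* ℂ) (ρ : Literature.NumberTheory.GaloisRepresentations.FramedGaloisRep K (PadicAlgCl ℓ) n), ρ.toGaloisRep.IsIrreducible → (∀ᶠ v : IsDedekindDomain.HeightOneSpectrum (NumberField.RingOfIntegers K) in cofinite, SatakeFrobCompatibleAt ι π.1 ρ v) → ∀ (v : IsDedekindDomain.HeightOneSpectrum (NumberField.RingOfIntegers K)) (hv : ((ℓ : ℕ) : NumberField.RingOfIntegers K) ∈ v.asIdeal), (Literature.NumberTheory.PAdicHodge.fontainePstAdicCompletion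 v ℓ hv).IsDeRhamFramed (ρ.toLocal v) ∧ ∀ (Rec : ReciprocityData K) (ℓ' : ℕ) [Fact ℓ'.Prime] (ι' : PadicAlgCl ℓ' ≃+* ℂ) (ρ' : Literature.NumberTheory.GaloisRepresentations.FramedGaloisRep K (PadicAlgCl ℓ') n), ((ℓ' : ℕ) : NumberField.RingOfIntegers K) ∉ v.asIdeal → ρ'.toGaloisRep.IsIrreducible → (∀ᶠ w : IsDedekindDomain.HeightOneSpectrum (NumberField.RingOfIntegers K) in cofinite, SatakeFrobCompatibleAt ι' π.1 ρ' w) → LocalGlobalCompatibleAt Rec ι' π.1 ρ' v → LocalGlobalCompatibleAt Rec ι π.1 ρ v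

/-- item stmt-Langlands-18084 · crux · rank 8 · open · by planner
why it might fail: away from ℓ the monodromy operator N is not known to match for non-polarizable π over CM K (compatibility up to Frobenius-semisimplification and N only in print), and nothing is known for K neither TR nor CM.
sources: ACC2023, Varma2024, TaylorYoshida2007, arXiv:2109.14145
[crux] L∤R — Taylor 2004 Conj. 7 at the places v ∤ ℓ, in the `∀ Rec` form (rev 4, lockstep re-type
after the summit re-type p141787 `∀ F, Nonempty (ReciprocityData F) ∧ ∀ 𝓡 …`): for every number
field K and EVERY reciprocity datum Rec (Henniart-normalised local Langlands data with THE canonical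
Artin pins — the summit's `∀ 𝓡`), every n ≥ 1 and hcpt, every L-algebraic cuspidal π of GL_n(𝔸_K),
every (ℓ, ι) and every IRREDUCIBLE ρ : Γ_K → GL_n(ℚ̄_ℓ) that is pinned-geometric (unramified a.e.,
de Rham above ℓ for Fontaine's pinned datum) and Satake–Frobenius compatible with (π, ι) a.e.:
`LocalGlobalCompatibleAt Rec ι π ρ v` at every finite v ∤ ℓ (Grothendieck–Deligne Weil–Deligne
representation, Frobenius-semisimplified, ↔ rec_v(π_v)). = item L∤ (stmt-Langlands-17417, ∃-Rec
form; verbatim the registered stub `stub_pairCompatibilityAway` of line `Sketch` of crux 14328) with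
Rec moved from `∃ Rec,` to a universal binder after K and nothing else changed; the ∃-form is
implied back by L∤R ∧ CanonicalReciprocityData (`compatibilityAwayFromL_existsForm`).
Kernel-certified consequence of the re-typed summit (`compatibilityAwayFromLR_of_langlands`, planner
bc/SubsOfLanglandsR.lean: direction (A -/
@[route_item "route-Langlands-HolomorphicLimitSplit", crux]
def CompatibilityAwayFromLR : Prop :=
  ∀ (K : Type) [Field K] [NumberField K] (Rec : ReciprocityData K) (n : ℕ) (hcpt : Literature.NumberTheory.Automorphic.isCompact_glFiniteIntegralLevel n K), 0 < n → ∀ (π : Literature.NumberTheory.Automorphic.CuspidalAutomorphicRepData n K hcpt), π.1.IsLAlgebraic → ∀ (ℓ : ℕ) [Fact ℓ.Prime] (ι : PadicAlgCl ℓ ≃+* ℂ) (ρ : Literature.NumberTheory.GaloisRepresentations.FramedGaloisRep K (PadicAlgCl ℓ) n), ρ.toGaloisRep.IsIrreducible → ((∀ᶠ v : IsDedekindDomain.HeightOneSpectrum (NumberField.RingOfIntegers K) in cofinite, ρ.IsUnramifiedAt v) ∧ ∀ (v : IsDedekindDomain.HeightOneSpectrum (NumberField.RingOfIntegers K)) (hv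 : ((ℓ : ℕ) : NumberField.RingOfIntegers K) ∈ v.asIdeal), (Literature.NumberTheory.PAdicHodge.fontainePstAdicCompletion v ℓ hv).IsDeRhamFramed (ρ.toLocal v)) → (∀ᶠ v : IsDedekindDomain.HeightOneSpectrum (NumberField.RingOfIntegers K) in cofinite, SatakeFrobCompatibleAt ι π.1 ρ v) → ∀ v : IsDedekindDomain.HeightOneSpectrum (NumberField.RingOfIntegers K), ((ℓ : ℕ) : NumberField.RingOfIntegers K) ∉ v.asIdeal → LocalGlobalCompatibleAt Rec ι π.1 ρ v

/-- item stmt-Langlands-17930 · support · rank 9 · open · by planner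
sources: HarrisTaylor2001
[support] THE SUMMIT'S NON-VACUITY CONJUNCT, verbatim (statement revision p141787, 2026-08-17:
`Langlands := ∀ F, Nonempty (ReciprocityData F) ∧ ∀ 𝓡 n, 0 < n → ∀ hcpt, GLC n F 𝓡 hcpt`, with
`ReciprocityData` pinned to THE local Artin maps by `llc_isCanonical` / `llc_eps_isCanonical`),
filed by route-repair 5a1bd9af as the explicit INPUT of this route's `∃ RD`-shaped slices
(LiftB2Unram, LiftB2UnramSmallF, LiftB2UnramLargeF, LiftB2UnramSplitP): for every number field F and
every finite place v, a local Langlands datum for GL_n(F_v) (Harris–Taylor 2001 Thm A; Henniart 2000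
Thm 1.2) normalised against THE local Artin map `canonicalArtin (F_v)`, whose ε-system (Deligne 1973
Thm 4.1) is normalised against the canonical Artin map of every finite E/F_v. IN PRINT,
textbook-grade input (Harris–Taylor's Thm A is stated relative to Art_K of local class field
theory); in the TREE not yet derivable — `LocalLanglandsDatum.nonempty` (cite-only) yields a datum
with SOME lawful Artin normalisation, and canonicity needs `IsLocalArtinMap.unique` + the
finite-level reciprocity law for that datum's Artin maps, or canonical variants of
`localLanglands_gl` / `nonempty_localEpsilonSystem` (needs-fact for -/
@[route_item "route-Langlands-HolomorphicLimitSplit", crux]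
def CanonicalReciprocityData : Prop :=
  ∀ (F : Type) [Field F] [NumberField F], Nonempty (Summit.Langlands.ReciprocityData F)

/-- item stmt-Langlands-31694 · support · rank 9 · open · by planner
sources: ArthurClozelAMS120, BuzzardGee2014
[support] [support] S1 — SOLVABLE GALOIS ASCENT of weak automorphy (PRINT given W⁺, which is inlined
as the first hypothesis; Langlands-implied, kernel `solvableGaloisAscent_of_weak`): K any number
field, ρ : Γ_K → GL_n(ℚ̄_ℓ) irreducible geometric and weakly automorphic (for every hcpt a cuspidal
L-algebraic π, Satake-compatible a.e.), E/K finite SOLVABLE GALOIS, ϑ an irreducible geometric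
constituent of ρ|E of rank m ≥ 1 (tr ρ|E = tr ϑ + tr ϑc) ⇒ ϑ is weakly automorphic over E. Proof in
print: composition series of Gal(E/K) into cyclic prime layers; Arthur–Clozel base change
III.4.2/III.5.1 at each layer (cuspidal or an isobaric orbit-sum, AC III.6), Clifford's theorem for
the restriction of ϑ_i, identification constituent-by-constituent with the irreducible W⁺ avatars by
Chebotarev density + Brauer–Nesbitt; L-algebraicity is preserved (restriction of L-parameters).
[difficulty: L] [difficulty: L] [TAGS: RESIDUAL MODE node lens-3-g7 WeilRestrictionSplit (bus L405;
sibling root-level route over the N0 PrimeSwitchSplit frame re-cutting B_w = WeakGeometricAutomorphy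
stmt-Langlands-17414), crit-1 CLEARED 2026-08-30T09:11:16Z STATUS L423 (CRITIC-LEDGER row 89; errata
e1 docblock-only, -/
@[route_item "route-Langlands-HolomorphicLimitSplit", crux]
def SolvableGaloisAscent : Prop :=
  (∀ (K : Type) [Field K] [NumberField K] (n : ℕ) (hcpt : Literature.NumberTheory.Automorphic.isCompact_glFiniteIntegralLevel n K), 0 < n → ∀ (π : Literature.NumberTheory.Automorphic.CuspidalAutomorphicRepData n K hcpt), π.1.IsLAlgebraic → ∀ (ℓ : ℕ) [Fact ℓ.Prime] (ι : PadicAlgCl ℓ ≃+* ℂ), ∃ ρ : Literature.NumberTheory.GaloisRepresentations.FramedGaloisRep K (PadicAlgCl ℓ) n, ρ.toGaloisRep.IsIrreducible ∧ ∀ᶠ v : IsDedekindDomain.HeightOneSpectrum (NumberField.RingOfIntegers K) in Filter.cofinite, SatakeFrobCompatibleAt ι π.1 ρ v) → ∀ (K : Type) [Field K] [NumberField K] (n : ℕ) (ℓ : ℕ) [Fact ℓ.Prime] (ι : PadicAlgCl ℓ ≃+* ℂ) (ρ : Literature.NumberTheory.GaloisRepresentations.FramedGaloisRep K (PadicAlgCl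 ℓ) n), ρ.toGaloisRep.IsIrreducible → ((∀ᶠ v : IsDedekindDomain.HeightOneSpectrum (NumberField.RingOfIntegers K) in Filter.cofinite, ρ.IsUnramifiedAt v) ∧ ∀ (v : IsDedekindDomain.HeightOneSpectrum (NumberField.RingOfIntegers K)) (hv : ((ℓ : ℕ) : NumberField.RingOfIntegers K) ∈ v.asIdeal), (Literature.NumberTheory.PAdicHodge.fontainePstAdicCompletion v ℓ hv).IsDeRhamFramed (ρ.toLocal v)) → 0 < n → (∀ hcpt : Literature.NumberTheory.Automorphic.isCompact_glFiniteIntegralLevel n K, ∃ π : Literature.NumberTheory.Automorphic.CuspidalAutomorphicRepData n K hcpt, π.1.IsLAlgebraic ∧ ∀ᶠ v : IsDedekindDomain.HeightOneSpectrum (NumberField.RingOfIntegers K) in Filter.cofinite, SatakeFrobCompatibleAt ι π.1 ρ v) → ∀ (E : Type) [Field E] [NumberField E] [Algebra K E], IsGalois K E → IsSolvable (E ≃ₐ[K] E) → ∀ (m : ℕ) (ϑ : Literature.NumberTheory.GaloisRepresentations.FramedGaloisRep E (PadicAlgCl ℓ) m), ϑ.toGaloisRep.IsIrreducible → ((∀ᶠ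 v : IsDedekindDomain.HeightOneSpectrum (NumberField.RingOfIntegers E) in Filter.cofinite, ϑ.IsUnramifiedAt v) ∧ ∀ (v : IsDedekindDomain.HeightOneSpectrum (NumberField.RingOfIntegers E)) (hv : ((ℓ : ℕ) : NumberField.RingOfIntegers E) ∈ v.asIdeal), (Literature.NumberTheory.PAdicHodge.fontainePstAdicCompletion v ℓ hv).IsDeRhamFramed (ϑ.toLocal v)) → (∃ (mc : ℕ) (θc : Literature.NumberTheory.GaloisRepresentations.FramedGaloisRep E (PadicAlgCl ℓ) mc), ∀ g : Field.absoluteGaloisGroup E, Literature.NumberTheory.GaloisRepresentations.FramedRep.trace (ρ.restrictField E) g = Literature.NumberTheory.GaloisRepresentations.FramedRep.trace ϑ g + Literature.NumberTheory.GaloisRepresentations.FramedRep.trace θc g) → 0 < m → ∀ hcptE : Literature.NumberTheory.Automorphic.isCompact_glFiniteIntegralLevel m E, ∃ π : Literature.NumberTheory.Automorphic.CuspidalAutomorphicRepData m E hcptE, π.1.IsLAlgebraic ∧ ∀ᶠ v : IsDedekindDomain.HeightOneSpectrum (NumberField.RingOfIntegers E) in Filter.cofinite, SatakeFrobCompatibleAt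 ι π.1 ϑ v

/-- item stmt-Langlands-31695 · support · rank 9 · open · by planner
sources: ArthurClozelAMS120, Henniart2012AI, Rajan2002
[support] [support] S2 — CLIFFORD SOLVABLE DESCENT (PRINT given W⁺, inlined; Langlands-implied,
kernel `cliffordSolvableDescent_of_weak`; generalises SolvableDescent 29341, which assumed ρ|E
irreducible): ρ irreducible geometric over K of rank n ≥ 1, E/K solvable Galois, ONE irreducible
constituent ϑ of ρ|E of rank ≥ 1 weakly automorphic over E ⇒ ρ weakly automorphic over K. Proof in
print along cyclic prime layers K_i ⊂ K_{i+1}, top down: the constituents of ρ|E are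
Gal(E/K)-conjugate (Clifford; conjugates of automorphic are automorphic); Clifford dichotomy
(`CliffordInducedPrimeIndex`): θ_i|K_{i+1} irreducible ⇒ its cuspidal Π is σ-invariant by strong
multiplicity one ⇒ Π = BC(π) (Arthur–Clozel III.4.2(b)), and ρ_π (W⁺ over K_i) ≅ θ_i ⊗ η^j for a
character η of the layer, so θ_i ↔ π ⊗ η^{-j}; θ_i|K_{i+1} reducible ⇒ θ_i = Ind θ_{i+1} ↔
automorphic induction AI(Π), cuspidal as Π ≄ Π^σ (AC III.6, Henniart 2012); L-algebraicity
preserved. [difficulty: L] [difficulty: L] [TAGS: RESIDUAL MODE node lens-3-g7 WeilRestrictionSplit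
(bus L405; sibling root-level route over the N0 PrimeSwitchSplit frame re-cutting B_w =
WeakGeometricAutomorphy stmt-Langlands-17414), crit-1 CLEARED 2026-08-3 -/
@[route_item "route-Langlands-HolomorphicLimitSplit", crux]
def CliffordSolvableDescent : Prop :=
  (∀ (K : Type) [Field K] [NumberField K] (n : ℕ) (hcpt : Literature.NumberTheory.Automorphic.isCompact_glFiniteIntegralLevel n K), 0 < n → ∀ (π : Literature.NumberTheory.Automorphic.CuspidalAutomorphicRepData n K hcpt), π.1.IsLAlgebraic → ∀ (ℓ : ℕ) [Fact ℓ.Prime] (ι : PadicAlgCl ℓ ≃+* ℂ), ∃ ρ : Literature.NumberTheory.GaloisRepresentations.FramedGaloisRep K (PadicAlgCl ℓ) n, ρ.toGaloisRep.IsIrreducible ∧ ∀ᶠ v : IsDedekindDomain.HeightOneSpectrum (NumberField.RingOfIntegers K) in Filter.cofinite, SatakeFrobCompatibleAt ι π.1 ρ v) → ∀ (K : Type) [Field K] [NumberField K] (n : ℕ) (ℓ : ℕ) [Fact ℓ.Prime] (ι : PadicAlgCl ℓ ≃+* ℂ) (ρ : Literature.NumberTheory.GaloisRepresentations.FramedGaloisRep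 K (PadicAlgCl ℓ) n), ρ.toGaloisRep.IsIrreducible → ((∀ᶠ v : IsDedekindDomain.HeightOneSpectrum (NumberField.RingOfIntegers K) in Filter.cofinite, ρ.IsUnramifiedAt v) ∧ ∀ (v : IsDedekindDomain.HeightOneSpectrum (NumberField.RingOfIntegers K)) (hv : ((ℓ : ℕ) : NumberField.RingOfIntegers K) ∈ v.asIdeal), (Literature.NumberTheory.PAdicHodge.fontainePstAdicCompletion v ℓ hv).IsDeRhamFramed (ρ.toLocal v)) → 0 < n → ∀ (E : Type) [Field E] [NumberField E] [Algebra K E], IsGalois K E → IsSolvable (E ≃ₐ[K] E) → ∀ (m : ℕ) (ϑ : Literature.NumberTheory.GaloisRepresentations.FramedGaloisRep E (PadicAlgCl ℓ) m), ϑ.toGaloisRep.IsIrreducible → (∃ (mc : ℕ) (θc : Literature.NumberTheory.GaloisRepresentations.FramedGaloisRep E (PadicAlgCl ℓ) mc), ∀ g : Field.absoluteGaloisGroup E, Literature.NumberTheory.GaloisRepresentations.FramedRep.trace (ρ.restrictField E) g = Literature.NumberTheory.GaloisRepresentations.FramedRep.trace ϑ g + Literature.NumberTheory.GaloisRepresentations.FramedRep.trace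 θc g) → 0 < m → (∀ hcptE : Literature.NumberTheory.Automorphic.isCompact_glFiniteIntegralLevel m E, ∃ π : Literature.NumberTheory.Automorphic.CuspidalAutomorphicRepData m E hcptE, π.1.IsLAlgebraic ∧ ∀ᶠ v : IsDedekindDomain.HeightOneSpectrum (NumberField.RingOfIntegers E) in Filter.cofinite, SatakeFrobCompatibleAt ι π.1 ϑ v) → ∀ hcpt : Literature.NumberTheory.Automorphic.isCompact_glFiniteIntegralLevel n K, ∃ π : Literature.NumberTheory.Automorphic.CuspidalAutomorphicRepData n K hcpt, π.1.IsLAlgebraic ∧ ∀ᶠ v : IsDedekindDomain.HeightOneSpectrum (NumberField.RingOfIntegers K) in Filter.cofinite, SatakeFrobCompatibleAt ι π.1 ρ v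

/-- item stmt-Langlands-31696 · support · rank 9 · closed · proved by Summit.Langlands.Langlands.Theorems.WeilRestrictionConstituent_proof (prover) · by planner
sources: SerreLinearRepresentations1977, FontaineAsterisque223III, BrinonConrad2009
[support] [support] S3 — WEIL-RESTRICTION CONSTITUENT (pure algebra + geometric heredity, PROVABLE
NOW, no automorphic input): for a tower of number fields F₀ ⊆ K ⊆ E and ρ : Γ_K → GL_n(ℚ̄_ℓ)
irreducible geometric (n ≥ 1) there are an irreducible geometric constituent ϑ of ρ|E of rank ≥ 1
(tr ρ|E = tr ϑ + tr ϑc) and an irreducible geometric R : Γ_{F₀} → GL_N(ℚ̄_ℓ), N ≥ 1, with ϑ a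
constituent of R|E (tr R|E = tr ϑ + tr Rc) — namely an irreducible constituent of the Weil
restriction Ind_E^{F₀} ϑ (tree `FramedGaloisRep.induce`; Frobenius reciprocity / Mackey identity
coset for ϑ ⊂ (Ind ϑ)|E; geometricity by `isDeRhamFramed_fontainePst_induce`,
`eventually_hasFrobCharpolyAt_induce` / `isUnramifiedAt_induce`, block heredity
`PstWeilDeligneData.isDeRhamFramed_blocks` as in `CliffordConstituentGeometric`; constituents
extracted as diagonal blocks `FramedRep.exists_eq_reindex_fromBlocks`). [difficulty: M] [difficulty:
M] [TAGS: RESIDUAL MODE node lens-3-g7 WeilRestrictionSplit (bus L405; sibling root-level route over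
the N0 PrimeSwitchSplit frame re-cutting B_w = WeakGeometricAutomorphy stmt-Langlands-17414), crit-1
CLEARED 2026-08-30T09:11:16Z STATUS L423 (CRITIC-LEDGER row 89; errata e1 -/
@[route_item "route-Langlands-HolomorphicLimitSplit", crux]
def WeilRestrictionConstituent : Prop :=
  ∀ (F₀ K E : Type) [Field F₀] [NumberField F₀] [Field K] [NumberField K] [Field E] [NumberField E] [Algebra F₀ K] [Algebra K E] [Algebra F₀ E] [IsScalarTower F₀ K E] (n : ℕ) (ℓ : ℕ) [Fact ℓ.Prime] (ρ : Literature.NumberTheory.GaloisRepresentations.FramedGaloisRep K (PadicAlgCl ℓ) n), ρ.toGaloisRep.IsIrreducible → ((∀ᶠ v : IsDedekindDomain.HeightOneSpectrum (NumberField.RingOfIntegers K) in Filter.cofinite, ρ.IsUnramifiedAt v) ∧ ∀ (v : IsDedekindDomain.HeightOneSpectrum (NumberField.RingOfIntegers K)) (hv : ((ℓ : ℕ) : NumberField.RingOfIntegers K) ∈ v.asIdeal), (Literature.NumberTheory.PAdicHodge.fontainePstAdicCompletion v ℓ hv).IsDeRhamFramed (ρ.toLocal v)) → 0 < n → ∃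 (m : ℕ) (ϑ : Literature.NumberTheory.GaloisRepresentations.FramedGaloisRep E (PadicAlgCl ℓ) m), 0 < m ∧ ϑ.toGaloisRep.IsIrreducible ∧ ((∀ᶠ v : IsDedekindDomain.HeightOneSpectrum (NumberField.RingOfIntegers E) in Filter.cofinite, ϑ.IsUnramifiedAt v) ∧ ∀ (v : IsDedekindDomain.HeightOneSpectrum (NumberField.RingOfIntegers E)) (hv : ((ℓ : ℕ) : NumberField.RingOfIntegers E) ∈ v.asIdeal), (Literature.NumberTheory.PAdicHodge.fontainePstAdicCompletion v ℓ hv).IsDeRhamFramed (ϑ.toLocal v)) ∧ (∃ (mc : ℕ) (θc : Literature.NumberTheory.GaloisRepresentations.FramedGaloisRep E (PadicAlgCl ℓ) mc), ∀ g : Field.absoluteGaloisGroup E, Literature.NumberTheory.GaloisRepresentations.FramedRep.trace (ρ.restrictField E) g = Literature.NumberTheory.GaloisRepresentations.FramedRep.trace ϑ g + Literature.NumberTheory.GaloisRepresentations.FramedRep.trace θc g) ∧ ∃ (N : ℕ) (R : Literature.NumberTheory.GaloisRepresentations.FramedGaloisRep F₀ (PadicAlgCl ℓ) N), 0 < N ∧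 R.toGaloisRep.IsIrreducible ∧ ((∀ᶠ v : IsDedekindDomain.HeightOneSpectrum (NumberField.RingOfIntegers F₀) in Filter.cofinite, R.IsUnramifiedAt v) ∧ ∀ (v : IsDedekindDomain.HeightOneSpectrum (NumberField.RingOfIntegers F₀)) (hv : ((ℓ : ℕ) : NumberField.RingOfIntegers F₀) ∈ v.asIdeal), (Literature.NumberTheory.PAdicHodge.fontainePstAdicCompletion v ℓ hv).IsDeRhamFramed (R.toLocal v)) ∧ (∃ (Nc : ℕ) (Rc : Literature.NumberTheory.GaloisRepresentations.FramedGaloisRep E (PadicAlgCl ℓ) Nc), ∀ g : Field.absoluteGaloisGroup E, Literature.NumberTheory.GaloisRepresentations.FramedRep.trace (R.restrictField E) g = Literature.NumberTheory.GaloisRepresentations.FramedRep.trace ϑ g + Literature.NumberTheory.GaloisRepresentations.FramedRep.trace Rc g)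

/-- `WeilRestrictionConstituent` holds: proved by `Summit.Langlands.Langlands.Theorems.WeilRestrictionConstituent_proof`. -/
theorem WeilRestrictionConstituent_holds : WeilRestrictionConstituent := _root_.Summit.Langlands.Langlands.Theorems.WeilRestrictionConstituent_proof

/-- item stmt-Langlands-31697 · support · rank 9 · open · by planner
sources: ArthurClozelAMS120, SerreAbelianLadic1968, HarrisSoudryTaylor1993
[support] [support] MT — TRANSPORT BACK ALONG ONE REGULARIZING MOVE (PRINT given W⁺, inlined; = S1 ∘
twist ∘ S2 bookkeeping; Langlands-implied, kernel `regularizingMoveTransport_of_weak`): R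
irreducible geometric over F₀ (rank n ≥ 1); K with F₀ ⊆ K ⊆ E₀, E₀/F₀ solvable Galois, and F₁ ⊆ K ⊆
E₁, E₁/F₁ solvable Galois; θ irreducible of rank m ≥ 1 with tr R|K = tr θ + tr θc; χ : Γ_K → ℚ̄_ℓ^×
continuous; R′ irreducible geometric over F₁ (rank n′ ≥ 1) with tr R′|K = tr χ · tr θ + tr θc′; R′
weakly automorphic over F₁ ⇒ R weakly automorphic over F₀. Chain: S1 along E₁/F₁ (constituents of
(θ⊗χ)|E₁ ⊂ R′|E₁ automorphic) ⇒ S2 along E₁/K (θ ⊗ χ automorphic over K) ⇒ χ is geometric (a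
constituent of (θ⊗χ) ⊗ θ^∨), hence the ℓ-adic avatar of an algebraic Hecke character ψ (class field
theory, Serre Abelian ℓ-adic III / Fontaine), and π ↦ π ⊗ ψ⁻¹ preserves cuspidality, L-algebraicity
and Satake compatibility ⇒ θ automorphic over K ⇒ S1 along E₀/K ⇒ S2 along E₀/F₀ for the irreducible
R. No regularity hypothesis is used (the support is stated for any move). [difficulty: M]
[difficulty: M] [TAGS: RESIDUAL MODE node lens-3-g7 WeilRestrictionSplit (bus L405; sibling
root-level route over the N0 PrimeSw -/
@[route_item "route-Langlands-HolomorphicLimitSplit", crux]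
def RegularizingMoveTransport : Prop :=
  (∀ (K : Type) [Field K] [NumberField K] (n : ℕ) (hcpt : Literature.NumberTheory.Automorphic.isCompact_glFiniteIntegralLevel n K), 0 < n → ∀ (π : Literature.NumberTheory.Automorphic.CuspidalAutomorphicRepData n K hcpt), π.1.IsLAlgebraic → ∀ (ℓ : ℕ) [Fact ℓ.Prime] (ι : PadicAlgCl ℓ ≃+* ℂ), ∃ ρ : Literature.NumberTheory.GaloisRepresentations.FramedGaloisRep K (PadicAlgCl ℓ) n, ρ.toGaloisRep.IsIrreducible ∧ ∀ᶠ v : IsDedekindDomain.HeightOneSpectrum (NumberField.RingOfIntegers K) in Filter.cofinite, SatakeFrobCompatibleAt ι π.1 ρ v) → ∀ (F₀ : Type) [Field F₀] [NumberField F₀] (n : ℕ) (ℓ : ℕ) [Fact ℓ.Prime] (ι : PadicAlgCl ℓ ≃+* ℂ) (R : Literature.NumberTheory.GaloisRepresentations.FramedGaloisRep F₀ (PadicAlgCl ℓ) n), R.toGaloisRep.IsIrreducible → ((∀ᶠ v : IsDedekindDomain.HeightOneSpectrum (NumberField.RingOfIntegers F₀) in Filter.cofinite, R.IsUnramifiedAt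 v) ∧ ∀ (v : IsDedekindDomain.HeightOneSpectrum (NumberField.RingOfIntegers F₀)) (hv : ((ℓ : ℕ) : NumberField.RingOfIntegers F₀) ∈ v.asIdeal), (Literature.NumberTheory.PAdicHodge.fontainePstAdicCompletion v ℓ hv).IsDeRhamFramed (R.toLocal v)) → 0 < n → ∀ (K E₀ : Type) [Field K] [NumberField K] [Field E₀] [NumberField E₀] [Algebra F₀ K] [Algebra K E₀] [Algebra F₀ E₀] [IsScalarTower F₀ K E₀] [IsGalois F₀ E₀], IsSolvable (E₀ ≃ₐ[F₀] E₀) → ∀ (F₁ E₁ : Type) [Field F₁] [NumberField F₁] [Field E₁] [NumberField E₁] [Algebra F₁ K] [Algebra K E₁] [Algebra F₁ E₁] [IsScalarTower F₁ K E₁] [IsGalois F₁ E₁], IsSolvable (E₁ ≃ₐ[F₁] E₁) → ∀ (m : ℕ) (θ : Literature.NumberTheory.GaloisRepresentations.FramedGaloisRep K (PadicAlgCl ℓ) m), 0 < m → θ.toGaloisRep.IsIrreducible → (∃ (mc : ℕ) (θc : Literature.NumberTheory.GaloisRepresentations.FramedGaloisRep K (PadicAlgCl ℓ) mc), ∀ g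 : Field.absoluteGaloisGroup K, Literature.NumberTheory.GaloisRepresentations.FramedRep.trace (R.restrictField K) g = Literature.NumberTheory.GaloisRepresentations.FramedRep.trace θ g + Literature.NumberTheory.GaloisRepresentations.FramedRep.trace θc g) → ∀ (χ : Literature.NumberTheory.GaloisRepresentations.FramedGaloisRep K (PadicAlgCl ℓ) 1) (n' : ℕ) (R' : Literature.NumberTheory.GaloisRepresentations.FramedGaloisRep F₁ (PadicAlgCl ℓ) n'), 0 < n' → R'.toGaloisRep.IsIrreducible → ((∀ᶠ v : IsDedekindDomain.HeightOneSpectrum (NumberField.RingOfIntegers F₁) in Filter.cofinite, R'.IsUnramifiedAt v) ∧ ∀ (v : IsDedekindDomain.HeightOneSpectrum (NumberField.RingOfIntegers F₁)) (hv : ((ℓ : ℕ) : NumberField.RingOfIntegers F₁) ∈ v.asIdeal), (Literature.NumberTheory.PAdicHodge.fontainePstAdicCompletion v ℓ hv).IsDeRhamFramed (R'.toLocal v)) → (∃ (mc' : ℕ) (θc' : Literature.NumberTheory.GaloisRepresentations.FramedGaloisRep K (PadicAlgCl ℓ) mc'), ∀ g : Field.absoluteGaloisGroup K, Literature.NumberTheory.GaloisRepresentations.FramedRep.trace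 (R'.restrictField K) g = Literature.NumberTheory.GaloisRepresentations.FramedRep.trace χ g * Literature.NumberTheory.GaloisRepresentations.FramedRep.trace θ g + Literature.NumberTheory.GaloisRepresentations.FramedRep.trace θc' g) → (∀ hcpt' : Literature.NumberTheory.Automorphic.isCompact_glFiniteIntegralLevel n' F₁, ∃ π : Literature.NumberTheory.Automorphic.CuspidalAutomorphicRepData n' F₁ hcpt', π.1.IsLAlgebraic ∧ ∀ᶠ v : IsDedekindDomain.HeightOneSpectrum (NumberField.RingOfIntegers F₁) in Filter.cofinite, SatakeFrobCompatibleAt ι π.1 R' v) → ∀ hcpt : Literature.NumberTheory.Automorphic.isCompact_glFiniteIntegralLevel n F₀, ∃ π : Literature.NumberTheory.Automorphic.CuspidalAutomorphicRepData n F₀ hcpt, π.1.IsLAlgebraic ∧ ∀ᶠ v : IsDedekindDomain.HeightOneSpectrum (NumberField.RingOfIntegers F₀) in Filter.cofinite, SatakeFrobCompatibleAt ι π.1 R v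

/-- item stmt-Langlands-32005 · support · rank 9 · open · by planner
why it might fail: Only via the transport: Arthur–Clozel ascent/descent along the solvable layers needs the Satake avatars W⁺ (17415) for the Brauer–Nesbitt matching of constituents over conjugation-solvable, possibly non-CM fields; it closes from MT 31697 ∧ W⁺, not from print alone.
sources: ArthurClozelAMS120, BuzzardGee2014, arXiv:0804.2860
[support] LMT — HOLOMORPHIC-LIMIT MOVE TRANSPORT (child 3/3 of IRR*_TR 31691, the SEAM of the split;
WEAKER than MT ∘ W⁺: kernel `limitMoveTransport_of_moveTransport : SatakeAvatarExistence →
RegularizingMoveTransport → LimitMoveTransport`, i.e. it closes the moment MT 31697 and W⁺ 17415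
close; Langlands-implied, kernel `limitMoveTransport_of_weak`): the parent's move transport
`RegularizingMoveTransport` with the W⁺ prefix DROPPED and the extra hypotheses «F₁ totally real»,
«rank R′ ≤ 4», «R′ totally odd-signed polarizable», «labelled HT multiplicities of R′ ≤ 2», «R′ not
HT-regular» ADDED: for R irreducible geometric over F₀, M conjugation-solvable w.r.t. F₀ (via E₀)
and w.r.t. the totally real F₁ (via E₁), θ an irreducible trace-constituent of R|M of rank ≥ 1, χ a
character of Γ_M and R′ over F₁ of holomorphic-limit type with θ ⊗ χ a trace-constituent of R′|M:
weak automorphy of R′ over F₁ (for every compact-level witness) ⇒ weak automorphy of R over F₀.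
Print route: R′ automorphic ⇒ (solvable Galois ascent along E₁/F₁, Arthur–Clozel III.4.2/III.5.1 +
Clifford + Brauer–Nesbitt with the Satake avatars) θχ automorphic over M ⇒ (χ algebraic by CFT/Weil;
untwist) θ automorphic ⇒ (as -/
@[route_item "route-Langlands-HolomorphicLimitSplit", crux]
def LimitMoveTransport : Prop :=
  ∀ (F₀ : Type) [Field F₀] [NumberField F₀] (n : ℕ) (ℓ : ℕ) [Fact ℓ.Prime] (ι : PadicAlgCl ℓ ≃+* ℂ) (R : Literature.NumberTheory.GaloisRepresentations.FramedGaloisRep F₀ (PadicAlgCl ℓ) n), R.toGaloisRep.IsIrreducible → ((∀ᶠ v : IsDedekindDomain.HeightOneSpectrum (NumberField.RingOfIntegers F₀) in Filter.cofinite, R.IsUnramifiedAt v) ∧ ∀ (v : IsDedekindDomain.HeightOneSpectrum (NumberField.RingOfIntegers F₀)) (hv : ((ℓ : ℕ) : NumberField.RingOfIntegers F₀) ∈ v.asIdeal), (Literature.NumberTheory.PAdicHodge.fontainePstAdicCompletion v ℓ hv).IsDeRhamFramed (R.toLocal v)) → 0 < n → ∀ (K E₀ : Type) [Field K] [NumberField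 K] [Field E₀] [NumberField E₀] [Algebra F₀ K] [Algebra K E₀] [Algebra F₀ E₀] [IsScalarTower F₀ K E₀] [IsGalois F₀ E₀], IsSolvable (E₀ ≃ₐ[F₀] E₀) → ∀ (F₁ E₁ : Type) [Field F₁] [NumberField F₁] [Field E₁] [NumberField E₁] [Algebra F₁ K] [Algebra K E₁] [Algebra F₁ E₁] [IsScalarTower F₁ K E₁] [IsGalois F₁ E₁], IsSolvable (E₁ ≃ₐ[F₁] E₁) → NumberField.IsTotallyReal F₁ → ∀ (m : ℕ) (θ : Literature.NumberTheory.GaloisRepresentations.FramedGaloisRep K (PadicAlgCl ℓ) m), 0 < m → θ.toGaloisRep.IsIrreducible → (∃ (mc : ℕ) (θc : Literature.NumberTheory.GaloisRepresentations.FramedGaloisRep K (PadicAlgCl ℓ) mc), ∀ g : Field.absoluteGaloisGroup K, Literature.NumberTheory.GaloisRepresentations.FramedRep.trace (R.restrictField K) g = Literature.NumberTheory.GaloisRepresentations.FramedRep.trace θ g + Literature.NumberTheory.GaloisRepresentations.FramedRep.trace θc g) → ∀ (χ : Literature.NumberTheory.GaloisRepresentations.FramedGaloisRep K (PadicAlgCl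 ℓ) 1) (n' : ℕ) (R' : Literature.NumberTheory.GaloisRepresentations.FramedGaloisRep F₁ (PadicAlgCl ℓ) n'), 0 < n' → R'.toGaloisRep.IsIrreducible → ((∀ᶠ v : IsDedekindDomain.HeightOneSpectrum (NumberField.RingOfIntegers F₁) in Filter.cofinite, R'.IsUnramifiedAt v) ∧ ∀ (v : IsDedekindDomain.HeightOneSpectrum (NumberField.RingOfIntegers F₁)) (hv : ((ℓ : ℕ) : NumberField.RingOfIntegers F₁) ∈ v.asIdeal), (Literature.NumberTheory.PAdicHodge.fontainePstAdicCompletion v ℓ hv).IsDeRhamFramed (R'.toLocal v)) → n' ≤ 4 → (∃ B : Matrix (Fin n') (Fin n') (PadicAlgCl ℓ), B.det ≠ 0 ∧ (Matrix.transpose B = B ∨ Matrix.transpose B = -B) ∧ (∀ g : Field.absoluteGaloisGroup F₁, ∃ s : PadicAlgCl ℓ, Matrix.transpose ((R' g : GL (Fin n') (PadicAlgCl ℓ)) : Matrix (Fin n') (Fin n') (PadicAlgCl ℓ)) * B * ((R' g : GL (Fin n') (PadicAlgCl ℓ)) : Matrix (Fin n') (Fin n') (PadicAlgCl ℓ)) =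 s • B) ∧ ∀ (φ : F₁ →+* ℝ) (c : Field.absoluteGaloisGroup F₁), Literature.NumberTheory.GaloisRepresentations.IsComplexConjugation φ c → Matrix.transpose (B * ((R' c : GL (Fin n') (PadicAlgCl ℓ)) : Matrix (Fin n') (Fin n') (PadicAlgCl ℓ))) = B * ((R' c : GL (Fin n') (PadicAlgCl ℓ)) : Matrix (Fin n') (Fin n') (PadicAlgCl ℓ))) → (∀ (v : IsDedekindDomain.HeightOneSpectrum (NumberField.RingOfIntegers F₁)) (hv : ((ℓ : ℕ) : NumberField.RingOfIntegers F₁) ∈ v.asIdeal), ∀ τ : v.adicCompletion F₁ →+* PadicAlgCl ℓ, Continuous τ → ∀ w : ℤ, Multiset.count w (R'.labelledHodgeTateWeightsAt v (Literature.NumberTheory.PAdicHodge.fontainePstAdicCompletion v ℓ hv).algebra (Literature.NumberTheory.PAdicHodge.fontainePstAdicCompletion v ℓ hv).𝔅 τ) ≤ 2) → ¬ (∀ (v : IsDedekindDomain.HeightOneSpectrum (NumberField.RingOfIntegers F₁)) (hv : ((ℓ : ℕ) : NumberField.RingOfIntegers F₁) ∈ v.asIdeal), ∀ τ : v.adicCompletion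 F₁ →+* PadicAlgCl ℓ, Continuous τ → (R'.labelledHodgeTateWeightsAt v (Literature.NumberTheory.PAdicHodge.fontainePstAdicCompletion v ℓ hv).algebra (Literature.NumberTheory.PAdicHodge.fontainePstAdicCompletion v ℓ hv).𝔅 τ).Nodup) → (∃ (mc' : ℕ) (θc' : Literature.NumberTheory.GaloisRepresentations.FramedGaloisRep K (PadicAlgCl ℓ) mc'), ∀ g : Field.absoluteGaloisGroup K, Literature.NumberTheory.GaloisRepresentations.FramedRep.trace (R'.restrictField K) g = Literature.NumberTheory.GaloisRepresentations.FramedRep.trace χ g * Literature.NumberTheory.GaloisRepresentations.FramedRep.trace θ g + Literature.NumberTheory.GaloisRepresentations.FramedRep.trace θc' g) → (∀ hcpt' : Literature.NumberTheory.Automorphic.isCompact_glFiniteIntegralLevel n' F₁, ∃ π : Literature.NumberTheory.Automorphic.CuspidalAutomorphicRepData n' F₁ hcpt', π.1.IsLAlgebraic ∧ ∀ᶠ v : IsDedekindDomain.HeightOneSpectrum (NumberField.RingOfIntegers F₁) in Filter.cofinite, SatakeFrobCompatibleAt ι π.1 R' v) → ∀ hcpt : Literature.NumberTheory.Automorphic.isCompact_glFiniteIntegralLevel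 n F₀, ∃ π : Literature.NumberTheory.Automorphic.CuspidalAutomorphicRepData n F₀ hcpt, π.1.IsLAlgebraic ∧ ∀ᶠ v : IsDedekindDomain.HeightOneSpectrum (NumberField.RingOfIntegers F₀) in Filter.cofinite, SatakeFrobCompatibleAt ι π.1 R v

/-- item stmt-Langlands-32091 · assembly · rank 1 · open · by planner
[assembly] the curried form of `closes`. [deps: HolomorphicLimitAutomorphy,
NonLimitIrregularAutomorphy, LimitMoveTransport, ConjugationInsolubleAutomorphy,
RegularTotallyRealAutomorphy, SolvableGaloisAscent, CliffordSolvableDescent,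
WeilRestrictionConstituent, RegularizingMoveTransport, SatakeAvatarExistence,
PadicMemberCompatibility, CompatibilityAwayFromLR, CanonicalReciprocityData] [difficulty: S] [TAGS:
RESIDUAL MODE node lens-3-g8 HolomorphicLimitSplit Shape B (bus L465/L466; CHILD route of
route-Langlands-WeilRestrictionSplit refining IRR*_TR = NonRegularizableAutomorphy
stmt-Langlands-31691 — the SAME decomposition already filed as the layer-2 split on
WeilRestrictionSplit rev 1 (HL 32003 / NL 32004 / LMT 32005 / glue 32006, dedup-shared here), opened
as a HOST so that refinements of HL (lens-5-g7 WeightOneBridgeSplit: OA/OB/PW1 ⊂ HL) and of NL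
(lens-3-g9) can be filed as layer-2 splits — a split of a layer-2 item on the parent route would be
a third layer), crit-1 g3 CLEARED 2026-08-30T10:05:40Z STATUS L477 (CRITIC-LEDGER row 101: «Shape B
child route (route.json 14 items, native OK, BC1 cone 7/13 WARN) CLEARED as to content (writer
weighs BC1)»); census of record HOME/cen -/
@[route_item "route-Langlands-HolomorphicLimitSplit"]
def Assembly : Prop :=
  HolomorphicLimitAutomorphy → NonLimitIrregularAutomorphy → LimitMoveTransport → ConjugationInsolubleAutomorphy → RegularTotallyRealAutomorphy → SolvableGaloisAscent → CliffordSolvableDescent → WeilRestrictionConstituent → RegularizingMoveTransport → SatakeAvatarExistence → PadicMemberCompatibility → CompatibilityAwayFromLR → CanonicalReciprocityData → Langlands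

/-! D-0027 §2.1 — DECIDING THEOREM (planner-authored via `route open/edit --closes-file`; by planner-decomp-langlands-writer-1-g3-0 2026-08-30T10:20:41Z):
its hypotheses are this route's items and its conclusion the sub-problem Statement (glue_lint), and it elaborates with this file. -/

@[closes "route-Langlands-HolomorphicLimitSplit"] theorem closes (hHL : HolomorphicLimitAutomorphy) (hNL : NonLimitIrregularAutomorphy) (hLMT : LimitMoveTransport)
    (hCI : ConjugationInsolubleAutomorphy) (hREG : RegularTotallyRealAutomorphy) (hS1 : SolvableGaloisAscent)
    (hS2 : CliffordSolvableDescent) (hS3 : WeilRestrictionConstituent) (hMT : RegularizingMoveTransport)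
    (hW : SatakeAvatarExistence) (hP : PadicMemberCompatibility) (hA : CompatibilityAwayFromLR)
    (hR : CanonicalReciprocityData) : _root_.Langlands := by
  refine Summit.Langlands.Langlands.Theses.WeilRestrictionSplit.closes ?_ hCI hREG hS1 hS2 hS3 hMT hW hP hA hR
  -- IRR*_TR from the three children: excluded middle on the holomorphic-limit move (node kernel `nonRegularizable_of_split`)
  intro K _ _ hK n hcpt hn ℓ _ ι ρ hirr hgeo hnm
  refine (Classical.em _).elim (fun hlim => ?_) (fun hnlim => hNL K hK n hcpt hn ℓ ι ρ hirr hgeo hnm hnlim)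
  obtain ⟨M, E₀, i₁, i₂, i₃, i₄, i₅, i₆, i₇, i₈, i₉, hsolv₀, F₁, E₁, j₁, j₂, j₃, j₄, j₅, j₆, j₇, j₈, j₉, hF₁, hsolv₁,
    m, θ, hm, hθirr, hθρ, χ, n', R', hn', hR'irr, hR'geo, h4, hodd, hmult, hθχ⟩ := hlim
  -- an HT-regular limit avatar would be a regularizing move, contradicting ¬ MOVE(ρ)
  have hnreg := fun hreg : _ => hnm ⟨M, E₀, i₁, i₂, i₃, i₄, i₅, i₆, i₇, i₈, i₉, hsolv₀, F₁, E₁, j₁, j₂, j₃, j₄, j₅,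
    j₆, j₇, j₈, j₉, hF₁, hsolv₁, m, θ, hm, hθirr, hθρ, χ, n', R', hn', hR'irr, hR'geo, hreg, hθχ⟩
  exact hLMT K n ℓ ι ρ hirr hgeo hn M E₀ hsolv₀ F₁ E₁ hsolv₁ hF₁ m θ hm hθirr hθρ χ n' R' hn' hR'irr hR'geo h4 hodd
    hmult hnreg hθχ (fun hcpt' => (Classical.em _).elim (fun hreg => (hnreg hreg).elim)
      (fun hreg => hHL F₁ hF₁ n' hcpt' hn' ℓ ι R' hR'irr hR'geo h4 hodd hmult hreg)) hcpt

end Summit.Langlands.Langlands.Theses.HolomorphicLimitSplit
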